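import Summits.PneNP.PneNP.Theses.KrwChromaticSteering
import Literature.Computability.Complexity.ApproximateMajorityAmplification
import Summits.PneNP.PneNP.Theorems.KrwChromaticSteeringCompositionIteration
import Summits.PneNP.PneNP.Theorems.KrwChromaticSteeringCompositionIterationFrac

/-!
# Crux `StrongComposition` (stmt-PneNP-18538) — EMBED sketch: the slice / semi-monotone host

Lens `embed` (LENSES-v3 §3.13), seat pnp-ideate-p5.  Host field F = the monotone / semi-monotone
KW-composition programme (de Rezende–Meir–Nordström–Pitassi–Robere 2020, arXiv:2007.02740, Def. 1 and
Conjecture 2; Meir 2023, arXiv:2306.00615, §1).  Special case C₀ = `SliceStrongComposition`: the STRONG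
semi-monotone composition theorem with `O(log mn)` loss for ONE middle-slice inner function per `n`.
Bridge C₀ → crux = the Berkowitz orientation trick for slice functions (Jukna 2012, Thm 10.1; in
KW-game form: Karchmer 1989, *Communication Complexity: A New Approach to Circuit Depth*, Thm 4.1.2 /
Cor. 4.1.1, `C(R¹) ≤ C(R) + O(log n)` on one slice, via Thm 4.1.1 = AKS83/Valiant84), played ROW-WISE
inside Meir's strong composition game: at a leaf `(i,j)` of an unoriented strong-composition protocol
the players spend `2 + depth(mKW(Th_k^n)) = O(log n)` further bits to reach an ORIENTED entry of the
same row.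

Everything below is problem-side scaffolding over existing declarations.  **v3 (g4, 2026-08-28):**
`ThresholdMonoLogDepth` (Karchmer 1989 Thm 4.1.1 = Valiant 1984 / Ajtai–Komlós–Szemerédi 1983: the
monotone KW game of every threshold `th_k^n` has complexity `O(log n)`) is no longer a hypothesis: it is
PROVED below (`thresholdMonoLogDepth_holds`, § Valiant, constant `18`), so the embed implication
`SliceStrongComposition → StrongComposition` is now UNCONDITIONAL
(`strongComposition_of_sliceStrongComposition'`).  The v2 typing of the fact quantified over `n = 0`,
where `KWTree (Fin 0)` is empty, and was therefore false (`not_thresholdMonoLogDepth_unguarded`) — the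
v2 bridge was vacuous; v3 adds the guard `1 ≤ n →` (the only instance the bridge ever used, since the crux
itself carries `1 ≤ n`).

**v4 (g5, 2026-08-28):** two kernel-checked additions, prefix unchanged.  (§ Converse) the CONVERSE of the
embedding at the fraction door by Berkowitz's doubling `x ↦ (x, x̄, 1…1)`: `StrongCompositionFrac(k) →
SliceStrongCompositionFrac(2k)`, hence `StrongCompositionFrac ↔ SliceStrongCompositionFrac` — at the door the
slice inner function and the ORIENTED inner game are without loss of generality, and C1 itself lands in
C₀-frac (`k₀ = 2`).  (§ Host) dRMNPR's Definition 1 (three-option semi-monotone game, `SolvesSemiMono`) and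
Conjecture 2 typed in two precise readings (`SemiMonotoneKRW`, `SemiMonotoneKRWFrac`), with
`SemiMonotoneKRW → SliceStrongComposition → C1` and `SemiMonotoneKRWFrac → SliceStrongCompositionFrac ↔ door`
given the rung P1 (`SliceMonoHardExist`, proved in `SliceMonoHard.lean`).

**v5 (g5, 2026-08-28):** (§ Direct) prefix unchanged; one new import (the landed S3,
`Theorems.KrwChromaticSteeringCompositionIteration`).  For a SLICE inner function the standard game
`KW_{f ⋄ h}` and dRMNPR's three-option semi-monotone game coincide up to the orienter (`orientSemi`: announce
`a_i, b_i`; equal labels = option 3, different labels = orient in row `i`), so weak KRW with a slice witness,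
weak KRW against semi-monotone protocols only (`SliceSemiMonoWeakKRW[Frac]`) and — by the doubling of
§ Converse — weak KRW itself coincide at the fraction scale (`weakKRWFrac_iff_sliceSemiMonoWeakKRWFrac`); and
Conjecture 2 + P1 give weak KRW DIRECTLY (`weakKRW_of_semiMonotoneKRW`), hence `P ⊄ NC¹` through the landed
`CompositionIteration_proof` and `PneNP` given the residual R (`pneNP_of_semiMonotoneKRW`) — WITHOUT the strong
game (C1) and WITHOUT `StandardFromStrong` (C2).  Honest framing: all of this is conditional on dRMNPR's
Conjecture 2 (open) or states equivalences between open statements; nothing here bears on P vs NP.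

**v6 (g5, 2026-08-28):** (§ v6, appended; prefix unchanged, no new import) the v5 chain is pointwise in the
outer function, hence relativises to any outer predicate `Φ` (`SemiMonotoneKRWFracFor Φ ∧ P1 ⟹
WeakKRWFracFor Φ`, `weakKRWFracFor_of`); at `Φ = EasyOuter` (`D(f)² ≤ 4m(⌊log₂ m⌋+1)²`) the companion workfile
`EasyOuterIterationFrac.lean` PROVES `EasyOuterWeakKRWFrac → P ⊄ NC¹` (KRW tower started at the dictator), so
Conjecture 2 is needed ONLY for polynomially easy outer `f` (`notNC1_of_semiMonotoneKRWFracEasy`).  Second new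
import: FILE B is LANDED (`Theorems/KrwChromaticSteeringCompositionIterationFrac.lean`, p615650), so the
hypothesis `CompositionIterationFrac` of the fraction chain is DISCHARGED (`compositionIterationFrac_holds'`,
`notNC1_of_semiMonotoneKRWFrac`, `pneNP_of_semiMonotoneKRWFrac'`): Conjecture 2-frac + P1 ⟹ `P ⊄ NC¹`
kernel-checked with P1 (proved in `SliceMonoHard.lean`, restated) as the only restated hypothesis.
-/

set_option autoImplicit false
set_option linter.dupNamespace false

namespace Summit.PneNP.PneNP.Cruxes.StrongComposition.SliceSemiMonotone

open Literature.Computability.Complexity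
open Literature.Computability.Complexity.KWTree

/-! ### Slice functions and the oriented (semi-monotone) strong composition game -/

/-- Hamming weight of a Boolean vector. -/
def wt {n : ℕ} (x : Fin n → Bool) : ℕ := (Finset.univ.filter fun j => x j = true).card

/-- The threshold function `Th_k^n`. -/
def thr (n k : ℕ) : (Fin n → Bool) → Bool := fun x => decide (k ≤ wt x)

/-- `h` is a `k`-slice function: `0` below weight `k`, `1` above weight `k` (free on the slice). -/
def IsSlice {n : ℕ} (k : ℕ) (h : (Fin n → Bool) → Bool) : Prop :=
  ∀ x, (wt x < k → h x = false) ∧ (k < wt x → h x = true)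

/-- `P` solves the STRONG SEMI-MONOTONE composition game `KW_f ⊛ mKW_h` (dRMNPR 2020 Def. 1 without its
third option, i.e. Meir's strong composition with the inner game oriented): the output entry `(i,j)` has
`h(X_i) ≠ h(Y_i)`, `X_{ij} = h(X_i)` and `Y_{ij} = h(Y_i)`. -/
def SolvesStrongMono {m n : ℕ} (P : KWTree (Fin m × Fin n)) (f : (Fin m → Bool) → Bool)
    (h : (Fin n → Bool) → Bool) : Prop :=
  ∀ X Y : Fin m × Fin n → Bool, blockComp f h X = true → blockComp f h Y = false →
    rowLabels h X (P.run X Y).1 ≠ rowLabels h Y (P.run X Y).1 ∧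
      X (P.run X Y) = rowLabels h X (P.run X Y).1 ∧ Y (P.run X Y) = rowLabels h Y (P.run X Y).1

/-- The monotone KW game of every threshold function `Th_k^n` (`n ≥ 1`) has a protocol of depth
`O(log n)` — Valiant 1984 (short monotone formulae for majority) / AKS 1983; PROVED below
(`thresholdMonoLogDepth_holds`).  (v2 stated this without the guard `1 ≤ n`, which is false at `n = 0`:
`not_thresholdMonoLogDepth_unguarded`.) -/
def ThresholdMonoLogDepth : Prop :=
  ∃ c : ℕ, ∀ n k : ℕ, 1 ≤ n →
    ∃ T : KWTree (Fin n), T.depth ≤ c * (Nat.log 2 n + 1) ∧ T.SolvesMono (thr n k)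

/-- **C₀ — the host's special case.**  Strong semi-monotone composition with `O(log mn)` loss holds for
SOME slice inner function of each arity: for every non-constant `f` there are `k` and a `k`-slice `h` on
`n` bits such that every protocol for `KW_f ⊛ mKW_h` yields a `KW_f` protocol shorter by `n − O(log mn)`. -/
def SliceStrongComposition : Prop :=
  ∃ c : ℕ, ∀ m n : ℕ, 1 ≤ n → ∀ f : (Fin m → Bool) → Bool, (∃ a b, f a ≠ f b) →
    ∃ k : ℕ, ∃ h : (Fin n → Bool) → Bool, IsSlice k h ∧
      ∀ P : KWTree (Fin m × Fin n), SolvesStrongMono P f h →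
        ∃ Q : KWTree (Fin m), Q.Solves f ∧ Q.depth + n ≤ P.depth + c * (Nat.log 2 (m * n) + 1)

/-! ### Grafting sub-protocols at the leaves -/

/-- Replace every leaf `ℓ` of `P` by the tree `G ℓ` (the players continue with a sub-protocol that may
depend on the transcript). -/
def graft {ι : Type*} : KWTree ι → (ι → KWTree ι) → KWTree ι
  | KWTree.leaf i, G => G i
  | KWTree.alice s P Q, G => KWTree.alice s (graft P G) (graft Q G)
  | KWTree.bob s P Q, G => KWTree.bob s (graft P G) (graft Q G)

theorem run_graft {ι : Type*} :
    ∀ (P : KWTree ι) (G : ι → KWTree ι) (a b : ι → Bool), (graft P G).run a b = (G (P.run a b)).run a b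
  | KWTree.leaf i, G, a, b => rfl
  | KWTree.alice s P Q, G, a, b => by
    simp only [graft, run_alice]
    split
    · exact run_graft Q G a b
    · exact run_graft P G a b
  | KWTree.bob s P Q, G, a, b => by
    simp only [graft, run_bob]
    split
    · exact run_graft Q G a b
    · exact run_graft P G a b

theorem depth_graft_le {ι : Type*} (G : ι → KWTree ι) (D : ℕ) (hG : ∀ i, (G i).depth ≤ D) :
    ∀ P : KWTree ι, (graft P G).depth ≤ P.depth + D
  | KWTree.leaf i => by simpa [graft] using hG i
  | KWTree.alice s P Q => by
    have hP := depth_graft_le G D hG P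
    have hQ := depth_graft_le G D hG Q
    simp only [graft, depth_alice]
    omega
  | KWTree.bob s P Q => by
    have hP := depth_graft_le G D hG P
    have hQ := depth_graft_le G D hG Q
    simp only [graft, depth_bob]
    omega

/-! ### The Berkowitz–Valiant orienter -/

/-- Row `i`, Alice keeps her row, Bob zeroes coordinate `j` of his; run the threshold protocol `T`. -/
def fixT {m n : ℕ} (T : KWTree (Fin n)) (i : Fin m) (j : Fin n) : KWTree (Fin m × Fin n) :=
  onRow i (T.comap (fun x => x) (fun y => Function.update y j false) (fun l => l))

/-- The same with the roles swapped (Bob holds the heavy row). -/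
def fixF {m n : ℕ} (T : KWTree (Fin n)) (i : Fin m) (j : Fin n) : KWTree (Fin m × Fin n) :=
  onRow i (T.comap (fun x => x) (fun y => Function.update y j false) (fun l => l)).swap

/-- The orienter grafted at leaf `(i,j)`: Alice announces `a_i = h(X_i)` and `X_{ij}`; if `X_{ij} = a_i`
the entry is already oriented, otherwise the threshold game on row `i` (with the offending coordinate
zeroed on the light side) produces an oriented entry. -/
def orient {m n : ℕ} (h : (Fin n → Bool) → Bool) (T : KWTree (Fin n)) (ij : Fin m × Fin n) :
    KWTree (Fin m × Fin n) :=
  KWTree.alice (fun X => rowLabels h X ij.1)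
    (KWTree.alice (fun X => X ij) (KWTree.leaf ij) (fixF T ij.1 ij.2))
    (KWTree.alice (fun X => X ij) (fixT T ij.1 ij.2) (KWTree.leaf ij))

@[simp] theorem run_fixT {m n : ℕ} (T : KWTree (Fin n)) (i : Fin m) (j : Fin n)
    (X Y : Fin m × Fin n → Bool) :
    (fixT T i j).run X Y = (i, T.run (row X i) (Function.update (row Y i) j false)) := by
  simp [fixT]

@[simp] theorem run_fixF {m n : ℕ} (T : KWTree (Fin n)) (i : Fin m) (j : Fin n)
    (X Y : Fin m × Fin n → Bool) :
    (fixF T i j).run X Y = (i, T.run (row Y i) (Function.update (row X i) j false)) := by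
  simp [fixF]

@[simp] theorem depth_fixT {m n : ℕ} (T : KWTree (Fin n)) (i : Fin m) (j : Fin n) :
    (fixT T i j).depth = T.depth := by
  simp [fixT]

@[simp] theorem depth_fixF {m n : ℕ} (T : KWTree (Fin n)) (i : Fin m) (j : Fin n) :
    (fixF T i j).depth = T.depth := by
  simp [fixF]

theorem depth_orient {m n : ℕ} (h : (Fin n → Bool) → Bool) (T : KWTree (Fin n)) (ij : Fin m × Fin n) :
    (orient h T ij).depth = T.depth + 2 := by
  simp [orient]

/-! ### Weight bookkeeping -/

theorem wt_update_false {n : ℕ} (y : Fin n → Bool) (j : Fin n) (hj : y j = true) :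
    wt (Function.update y j false) + 1 = wt y := by
  unfold wt
  have hset : (Finset.univ.filter fun l => Function.update y j false l = true) =
      (Finset.univ.filter fun l => y l = true).erase j := by
    ext l
    by_cases hl : l = j
    · subst hl
      simp
    · simp [hl]
  have hmem : j ∈ (Finset.univ.filter fun l => y l = true) := by simpa using hj
  rw [hset, Finset.card_erase_of_mem hmem]
  have : 1 ≤ (Finset.univ.filter fun l => y l = true).card := Finset.card_pos.2 ⟨j, hmem⟩
  omega

theorem le_wt_of_true {n k : ℕ} {h : (Fin n → Bool) → Bool} (hs : IsSlice k h) {x : Fin n → Bool}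
    (hx : h x = true) : k ≤ wt x := by
  by_contra hlt
  have := (hs x).1 (by omega)
  simp [this] at hx

theorem wt_le_of_false {n k : ℕ} {h : (Fin n → Bool) → Bool} (hs : IsSlice k h) {x : Fin n → Bool}
    (hx : h x = false) : wt x ≤ k := by
  by_contra hlt
  have := (hs x).2 (by omega)
  simp [this] at hx

/-- The threshold game separates a heavy row from a light row with one `1` removed. -/
theorem thr_sep {n k : ℕ} {x y : Fin n → Bool} {j : Fin n} (hx : k ≤ wt x) (hy : wt y ≤ k)
    (hj : y j = true) :
    thr n k x = true ∧ thr n k (Function.update y j false) = false := by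
  have h1 := wt_update_false y j hj
  refine ⟨by simp [thr, hx], ?_⟩
  simp only [thr, decide_eq_false_iff_not, not_le]
  omega

/-! ### The orienter is correct -/

theorem eq_not_of_ne {a b : Bool} (hab : a ≠ b) : b = !a := by
  cases a <;> cases b <;> simp at hab ⊢

theorem solvesStrongMono_graft_orient {m n k : ℕ} {f : (Fin m → Bool) → Bool}
    {h : (Fin n → Bool) → Bool} {T : KWTree (Fin n)} {P : KWTree (Fin m × Fin n)}
    (hs : IsSlice k h) (hT : T.SolvesMono (thr n k)) (hP : P.SolvesStrong f h) :
    SolvesStrongMono (graft P (orient h T)) f h := by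
  intro X Y hX hY
  obtain ⟨hne, hab⟩ := hP X Y hX hY
  rw [run_graft]
  generalize hij : P.run X Y = ij at hne hab
  obtain ⟨i, j⟩ := ij
  have hab' : h (row X i) ≠ h (row Y i) := hab
  have hb := eq_not_of_ne hab'
  have hy := eq_not_of_ne hne
  -- the four cases of (a_i, X_ij)
  cases ha : h (row X i) <;> cases hx : X (i, j) <;> simp only [ha, hx, Bool.not_false, Bool.not_true] at hb hy
  · -- a_i = 0, X_ij = 0 : already oriented
    simp [orient, rowLabels, ha, hx, hb, hy]
  · -- a_i = 0, X_ij = 1 : Bob holds the heavy row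
    have hwy : k ≤ wt (row Y i) := le_wt_of_true hs hb
    have hwx : wt (row X i) ≤ k := wt_le_of_false hs ha
    obtain ⟨h1, h2⟩ := thr_sep hwy hwx (show row X i j = true by simpa using hx)
    obtain ⟨hT1, hT2⟩ := hT _ _ h1 h2
    set j' := T.run (row Y i) (Function.update (row X i) j false) with hj'
    have hjj : j' ≠ j := by
      rintro hjj
      rw [hjj] at hT1
      simp [hy] at hT1
    have hX' : X (i, j') = false := by
      simpa [Function.update_of_ne hjj] using hT2
    have hY' : Y (i, j') = true := by simpa using hT1
    simp [orient, rowLabels, ha, hx, hb, ← hj', hX', hY']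
  · -- a_i = 1, X_ij = 0 : Alice holds the heavy row
    have hwx : k ≤ wt (row X i) := le_wt_of_true hs ha
    have hwy : wt (row Y i) ≤ k := wt_le_of_false hs hb
    obtain ⟨h1, h2⟩ := thr_sep hwx hwy (show row Y i j = true by simpa using hy)
    obtain ⟨hT1, hT2⟩ := hT _ _ h1 h2
    set j' := T.run (row X i) (Function.update (row Y i) j false) with hj'
    have hjj : j' ≠ j := by
      rintro hjj
      rw [hjj] at hT1
      simp [hx] at hT1
    have hY' : Y (i, j') = false := by
      simpa [Function.update_of_ne hjj] using hT2
    have hX' : X (i, j') = true := by simpa using hT1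
    simp [orient, rowLabels, ha, hx, hb, ← hj', hX', hY']
  · -- a_i = 1, X_ij = 1 : already oriented
    simp [orient, rowLabels, ha, hx, hb, hy]

/-! ### The bridge: C₀ → the crux -/

theorem one_le_of_nonconst {m : ℕ} {f : (Fin m → Bool) → Bool} (hf : ∃ a b, f a ≠ f b) : 1 ≤ m := by
  by_contra hm
  have hm0 : m = 0 := by omega
  subst hm0
  obtain ⟨a, b, hab⟩ := hf
  exact hab (congrArg f (Subsingleton.elim a b))

/-- **EMBED IMPLICATION (kernel-checked), parametric form.**  Strong semi-monotone composition for one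
slice inner function per arity (`SliceStrongComposition`, the host's C₀), together with `O(log n)`-depth
monotone threshold protocols (`ThresholdMonoLogDepth`, proved below), implies the route crux
`StrongComposition` of `KrwChromaticSteering` — with the SAME inner function `g := h` and constant
`c₀ + c_T + 2`.  Unconditional form: `strongComposition_of_sliceStrongComposition'`. -/
theorem strongComposition_of_sliceStrongComposition (hT : ThresholdMonoLogDepth)
    (h0 : SliceStrongComposition) :
    Summit.PneNP.PneNP.Theses.KrwChromaticSteering.StrongComposition := by
  obtain ⟨cT, hcT⟩ := hT
  obtain ⟨c0, hc0⟩ := h0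
  refine ⟨c0 + cT + 2, fun m n hn f hf => ?_⟩
  obtain ⟨k, h, hs, hh⟩ := hc0 m n hn f hf
  obtain ⟨T, hTd, hTs⟩ := hcT n k hn
  refine ⟨h, fun P hP => ?_⟩
  obtain ⟨Q, hQ, hQd⟩ := hh (graft P (orient h T)) (solvesStrongMono_graft_orient hs hTs hP)
  refine ⟨Q, hQ, ?_⟩
  have hdep : (graft P (orient h T)).depth ≤ P.depth + (T.depth + 2) :=
    depth_graft_le _ _ (fun ij => (depth_orient h T ij).le) P
  have hm : 1 ≤ m := one_le_of_nonconst hf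
  have hlog : Nat.log 2 n ≤ Nat.log 2 (m * n) := Nat.log_mono_right (Nat.le_mul_of_pos_left n hm)
  have hT' : T.depth ≤ cT * (Nat.log 2 (m * n) + 1) :=
    hTd.trans (Nat.mul_le_mul_left _ (by omega))
  have hsplit : (c0 + cT + 2) * (Nat.log 2 (m * n) + 1) =
      c0 * (Nat.log 2 (m * n) + 1) + cT * (Nat.log 2 (m * n) + 1) + 2 * (Nat.log 2 (m * n) + 1) := by
    ring
  rw [hsplit]
  omega

/-! ### Variant A — the fraction door (pre-typed NEXT line)

If the `+n` slice form is judged too strong, the same orientation bridge lands the slice embedding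
on the WEAKER re-target `InnerFractionDoor.StrongCompositionFrac` (gain `n / k₀`, card
inner-fraction-door, whose `closes_frac` still decides the sub-problem); the conclusion below is its
verbatim body. -/

/-- **C₀-frac.** Strong semi-monotone composition for a slice inner function with a constant
FRACTION `n / k₀` of the inner depth gained. -/
def SliceStrongCompositionFrac : Prop :=
  ∃ c k₀ : ℕ, 0 < k₀ ∧ ∀ m n : ℕ, 1 ≤ n → ∀ f : (Fin m → Bool) → Bool, (∃ a b, f a ≠ f b) →
    ∃ k : ℕ, ∃ h : (Fin n → Bool) → Bool, IsSlice k h ∧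
      ∀ P : KWTree (Fin m × Fin n), SolvesStrongMono P f h →
        ∃ Q : KWTree (Fin m), Q.Solves f ∧ Q.depth + n / k₀ ≤ P.depth + c * (Nat.log 2 (m * n) + 1)

/-- `C₀ → C₀-frac` (`k₀ = 1`). -/
theorem sliceStrongCompositionFrac_of_sliceStrongComposition (h0 : SliceStrongComposition) :
    SliceStrongCompositionFrac := by
  obtain ⟨c0, hc0⟩ := h0
  refine ⟨c0, 1, Nat.one_pos, fun m n hn f hf => ?_⟩
  obtain ⟨k, h, hs, hh⟩ := hc0 m n hn f hf
  refine ⟨k, h, hs, fun P hP => ?_⟩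
  obtain ⟨Q, hQ, hQd⟩ := hh P hP
  exact ⟨Q, hQ, by simpa using hQd⟩

/-- **EMBED IMPLICATION, fraction form (kernel-checked).** `C₀-frac` together with
`ThresholdMonoLogDepth` implies the inner-fraction door `StrongCompositionFrac` (same `k₀`,
constant `c₀ + c_T + 2`, inner function `g := h`). -/
theorem strongCompositionFrac_of_sliceStrongCompositionFrac (hT : ThresholdMonoLogDepth)
    (h0 : SliceStrongCompositionFrac) :
    -- verbatim body of `InnerFractionDoor.StrongCompositionFrac` (Cruxes/…/InnerFractionDoorSketch.lean,
    -- not imported here: that module is not in the farm build)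
    ∃ c k : ℕ, 0 < k ∧ ∀ m n : ℕ, 1 ≤ n → ∀ f : (Fin m → Bool) → Bool, (∃ a b, f a ≠ f b) →
      ∃ g : (Fin n → Bool) → Bool, ∀ P : KWTree (Fin m × Fin n), P.SolvesStrong f g →
        ∃ Q : KWTree (Fin m), Q.Solves f ∧ Q.depth + n / k ≤ P.depth + c * (Nat.log 2 (m * n) + 1) := by
  obtain ⟨cT, hcT⟩ := hT
  obtain ⟨c0, k₀, hk₀, hc0⟩ := h0
  refine ⟨c0 + cT + 2, k₀, hk₀, fun m n hn f hf => ?_⟩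
  obtain ⟨k, h, hs, hh⟩ := hc0 m n hn f hf
  obtain ⟨T, hTd, hTs⟩ := hcT n k hn
  refine ⟨h, fun P hP => ?_⟩
  obtain ⟨Q, hQ, hQd⟩ := hh (graft P (orient h T)) (solvesStrongMono_graft_orient hs hTs hP)
  refine ⟨Q, hQ, ?_⟩
  have hdep : (graft P (orient h T)).depth ≤ P.depth + (T.depth + 2) :=
    depth_graft_le _ _ (fun ij => (depth_orient h T ij).le) P
  have hm : 1 ≤ m := one_le_of_nonconst hf
  have hlog : Nat.log 2 n ≤ Nat.log 2 (m * n) := Nat.log_mono_right (Nat.le_mul_of_pos_left n hm)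
  have hT' : T.depth ≤ cT * (Nat.log 2 (m * n) + 1) :=
    hTd.trans (Nat.mul_le_mul_left _ (by omega))
  have hsplit : (c0 + cT + 2) * (Nat.log 2 (m * n) + 1) =
      c0 * (Nat.log 2 (m * n) + 1) + cT * (Nat.log 2 (m * n) + 1) + 2 * (Nat.log 2 (m * n) + 1) := by
    ring
  rw [hsplit]
  omega

/-! ### Calibration — the `m = 1` shadow of C₀ is "hard slices exist"

With the outer function the 1-bit identity, C₀ says exactly that some slice function has MONOTONE
Karchmer–Wigderson depth `≥ n − O(log n)` — true by counting (`2^{C(n,⌊n/2⌋)}` middle slices against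
`< 2^{2^{d+1}(2n+4)}` protocols of depth `d`; the pattern of `KWDepthHardFunctions.lean`), named here
as the support rung P1 `SliceMonoHardExist` (to be proved by a prover; it is NECESSARY for C₀). -/

/-- **P1 (support rung).** Some slice function of each arity needs monotone KW depth
`≥ n − c·(log₂ n + 1)`. -/
def SliceMonoHardExist : Prop :=
  ∃ c : ℕ, ∀ n : ℕ, 1 ≤ n → ∃ k : ℕ, ∃ h : (Fin n → Bool) → Bool, IsSlice k h ∧
    ∀ T : KWTree (Fin n), T.SolvesMono h → n ≤ T.depth + c * (Nat.log 2 n + 1)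

/-- C₀ with `m = 1`, `f = (a ↦ a 0)` is P1: the one-row oriented strong game IS the monotone game of
the inner function. -/
theorem sliceMonoHardExist_of_sliceStrongComposition (h0 : SliceStrongComposition) :
    SliceMonoHardExist := by
  obtain ⟨c0, hc0⟩ := h0
  refine ⟨c0, fun n hn => ?_⟩
  have hf : ∃ a b : Fin 1 → Bool,
      (fun a : Fin 1 → Bool => a 0) a ≠ (fun a : Fin 1 → Bool => a 0) b :=
    ⟨fun _ => true, fun _ => false, by simp⟩
  obtain ⟨k, h, hs, hh⟩ := hc0 1 n hn (fun a => a 0) hf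
  refine ⟨k, h, hs, fun T hT => ?_⟩
  have hP : SolvesStrongMono (onRow (0 : Fin 1) T) (fun a => a 0) h := by
    intro X Y hX hY
    simp only [blockComp, rowLabels] at hX hY
    obtain ⟨h1, h2⟩ := hT (row X 0) (row Y 0) hX hY
    simp only [run_onRow, rowLabels, hX, hY]
    exact ⟨by simp, h1, h2⟩
  obtain ⟨Q, -, hQd⟩ := hh _ hP
  simp only [depth_onRow, one_mul] at hQd
  omega


/-! ## § Valiant — proof of `ThresholdMonoLogDepth` (v3)

Valiant's probabilistic construction in the `Maj₃` form (Gupta–Mahajan / Goldreich's exposition), carried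
out directly on PROTOCOL TREES so that no formula ↔ protocol conversion is needed:

* pad `Th_k^n` to `Maj_{2n+1}` with `n+1-k` constant-`1` and `k` constant-`0` virtual literals (`V`, `virt`);
* level `0`: a uniformly random virtual literal; level `j+1`: `Maj₃` of three independent level-`j` seeds
  (`LevelInv`, `levelInv_succ`); the acceptance COUNT at a virtual assignment with a fraction `q` of true
  literals is exactly `|T| · A^{(j)}(q)`, `A(p) = 3p² − 2p³` (`frac_maj3`, exact counting, no probability);
* amplification: `A(1/2+δ) ≥ 1/2 + (11/8)δ` for `δ ≤ 1/4` and `1 − A(1−e) ≤ 3e²`, whence after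
  `levels n = 4⌊log₂ n⌋ + 6` levels the error is `≤ (1/3)·2^{-n}` from the initial bias `1/(2(2n+1))`
  (`iterate_A_levels`);
* Adleman's union bound over the `2^n` real inputs (`exists_seed_of_frac` of
  `Literature/…/ApproximateMajorityAmplification.lean`) fixes one seed correct everywhere; its protocol —
  `Maj₃(f,g,h) = (f ∧ g) ∨ ((f ∨ g) ∧ h)` costs `3` rounds per level (`majTree`) — solves the monotone KW game
  of `Th_k^n` in depth `≤ 3 · levels n ≤ 18(⌊log₂ n⌋ + 1)`.
-/

open Finset

/-! ### Valiant's amplification function `A(p) = 3p² − 2p³` (probability that `Maj₃` of three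
independent `p`-coins is `1`) -/

/-- `A p = 3 p² − 2 p³`. -/
noncomputable def A (p : ℝ) : ℝ := 3 * p ^ 2 - 2 * p ^ 3

theorem A_symm (p : ℝ) : A (1 - p) = 1 - A p := by
  unfold A; ring

theorem A_nonneg {p : ℝ} (_h0 : 0 ≤ p) (h1 : p ≤ 1) : 0 ≤ A p := by
  unfold A; nlinarith [mul_nonneg (sq_nonneg p) (by linarith : (0 : ℝ) ≤ 3 - 2 * p)]

theorem A_le_one {p : ℝ} (h0 : 0 ≤ p) (_h1 : p ≤ 1) : A p ≤ 1 := by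
  unfold A; nlinarith [mul_nonneg (sq_nonneg (1 - p)) (by linarith : (0 : ℝ) ≤ 1 + 2 * p)]

theorem A_mono {p q : ℝ} (hp : 0 ≤ p) (hpq : p ≤ q) (hq : q ≤ 1) : A p ≤ A q := by
  have hq0 : 0 ≤ q := hp.trans hpq
  have hp1 : p ≤ 1 := hpq.trans hq
  have key : 0 ≤ 3 * (p + q) - 2 * (p ^ 2 + p * q + q ^ 2) := by
    nlinarith [mul_nonneg hp (sub_nonneg.2 hp1), mul_nonneg hq0 (sub_nonneg.2 hq),
      mul_nonneg hp (sub_nonneg.2 hq)]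
  unfold A
  nlinarith [mul_nonneg (sub_nonneg.2 hpq) key]

/-- Phase 1 (linear amplification around `1/2`): `A(1/2 + δ) ≥ 1/2 + (11/8) δ` for `0 ≤ δ ≤ 1/4`. -/
theorem A_half_step {δ : ℝ} (h0 : 0 ≤ δ) (h1 : δ ≤ 1 / 4) :
    1 / 2 + 11 / 8 * δ ≤ A (1 / 2 + δ) := by
  have h : 0 ≤ δ * ((1 / 4 - δ) * (1 / 4 + δ)) :=
    mul_nonneg h0 (mul_nonneg (by linarith) (by linarith))
  unfold A; nlinarith [h]

/-- Phase 2 (quadratic convergence near `1`): `1 − A(1 − e) ≤ 3 e²` for `0 ≤ e`. -/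
theorem A_top_step {e : ℝ} (h0 : 0 ≤ e) : 1 - A (1 - e) ≤ 3 * e ^ 2 := by
  rw [A_symm]; unfold A; nlinarith [pow_nonneg h0 3]

theorem iterate_A_mem (j : ℕ) {p : ℝ} (h0 : 0 ≤ p) (h1 : p ≤ 1) :
    0 ≤ A^[j] p ∧ A^[j] p ≤ 1 := by
  induction j with
  | zero => exact ⟨h0, h1⟩
  | succ j ih =>
    rw [Function.iterate_succ_apply']
    exact ⟨A_nonneg ih.1 ih.2, A_le_one ih.1 ih.2⟩

theorem iterate_A_mono (j : ℕ) {p q : ℝ} (hp : 0 ≤ p) (hpq : p ≤ q) (hq : q ≤ 1) :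
    A^[j] p ≤ A^[j] q := by
  induction j with
  | zero => exact hpq
  | succ j ih =>
    rw [Function.iterate_succ_apply', Function.iterate_succ_apply']
    exact A_mono (iterate_A_mem j hp (hpq.trans hq)).1 ih (iterate_A_mem j (hp.trans hpq) hq).2

theorem iterate_A_symm (j : ℕ) (p : ℝ) : A^[j] (1 - p) = 1 - A^[j] p := by
  induction j with
  | zero => rfl
  | succ j ih => rw [Function.iterate_succ_apply', Function.iterate_succ_apply', ih, A_symm]

theorem iterate_A_phase1 (j : ℕ) {p δ : ℝ} (hδ : 0 ≤ δ) (hp : 1 / 2 + δ ≤ p) (hp1 : p ≤ 1) :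
    1 / 2 + min ((11 / 8) ^ j * δ) (1 / 4) ≤ A^[j] p := by
  induction j with
  | zero =>
    have : min ((11 / 8 : ℝ) ^ 0 * δ) (1 / 4) ≤ δ := by rw [pow_zero, one_mul]; exact min_le_left _ _
    simpa using (by linarith : 1 / 2 + min ((11 / 8 : ℝ) ^ 0 * δ) (1 / 4) ≤ p)
  | succ j ih =>
    set δj : ℝ := min ((11 / 8) ^ j * δ) (1 / 4) with hδj
    have hδj0 : 0 ≤ δj := le_min (by positivity) (by norm_num)
    have hδj1 : δj ≤ 1 / 4 := min_le_right _ _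
    have hmem := iterate_A_mem j (by linarith : (0 : ℝ) ≤ p) hp1
    rw [Function.iterate_succ_apply']
    have h1 : A (1 / 2 + δj) ≤ A (A^[j] p) := A_mono (by linarith) ih hmem.2
    have h2 := A_half_step hδj0 hδj1
    have h3 : min ((11 / 8 : ℝ) ^ (j + 1) * δ) (1 / 4) ≤ 11 / 8 * δj := by
      rcases le_total ((11 / 8 : ℝ) ^ j * δ) (1 / 4) with h | h
      · rw [hδj, min_eq_left h, pow_succ]
        nlinarith [min_le_left ((11 / 8 : ℝ) ^ j * (11 / 8) * δ) (1 / 4)]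
      · rw [hδj, min_eq_right h]
        linarith [min_le_right ((11 / 8 : ℝ) ^ (j + 1) * δ) (1 / 4)]
    linarith

theorem iterate_A_phase2 (j : ℕ) {p : ℝ} (hp : 3 / 4 ≤ p) (hp1 : p ≤ 1) :
    3 * (1 - A^[j] p) ≤ (3 / 4) ^ (2 ^ j) := by
  induction j with
  | zero => simp only [pow_zero, Function.iterate_zero, id_eq, pow_one]; linarith
  | succ j ih =>
    have hmem := iterate_A_mem j (by linarith : (0 : ℝ) ≤ p) hp1
    have he0 : 0 ≤ 1 - A^[j] p := sub_nonneg.2 hmem.2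
    rw [Function.iterate_succ_apply']
    have h1 : 1 - A (A^[j] p) ≤ 3 * (1 - A^[j] p) ^ 2 := by
      have := A_top_step he0
      rwa [sub_sub_cancel] at this
    have h2 : (3 * (1 - A^[j] p)) ^ 2 ≤ ((3 / 4 : ℝ) ^ (2 ^ j)) ^ 2 :=
      pow_le_pow_left₀ (by linarith) ih 2
    rw [pow_succ, pow_mul]
    nlinarith [h1, h2]

/-- Number of `Maj₃` levels used: `4 ⌊log₂ n⌋ + 6`. -/
def levels (n : ℕ) : ℕ := 4 * Nat.log 2 n + 6

/-- The end-to-end amplification bound: starting from bias `≥ 1/2 + 1/(2(2n+1))`, after `levels n`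
iterations the rejection probability is `≤ (1/3)·2^{-n}`. -/
theorem iterate_A_levels {n : ℕ} {p : ℝ} (hp : ((n : ℝ) + 1) / (2 * n + 1) ≤ p) (hp1 : p ≤ 1) :
    1 - A^[levels n] p ≤ 1 / 3 * (1 / 2) ^ n := by
  set L := Nat.log 2 n with hL
  have h2L : n < 2 ^ (L + 1) := Nat.lt_pow_succ_log_self one_lt_two n
  have h2L' : (n : ℝ) + 1 ≤ 2 ^ (L + 1) := by exact_mod_cast h2L
  have hn0 : (0 : ℝ) ≤ n := Nat.cast_nonneg n
  -- phase 1
  set δ : ℝ := 1 / (2 * (2 * n + 1)) with hδ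
  have hδ0 : 0 ≤ δ := by positivity
  have hpδ : 1 / 2 + δ ≤ p := by
    have : (1 : ℝ) / 2 + δ = ((n : ℝ) + 1) / (2 * n + 1) := by
      rw [hδ]; field_simp; ring
    rw [this]; exact hp
  have hph1 := iterate_A_phase1 (3 * (L + 1)) hδ0 hpδ hp1
  have hbig : 1 / 4 ≤ (11 / 8 : ℝ) ^ (3 * (L + 1)) * δ := by
    have h1 : (2 : ℝ) ^ (L + 1) ≤ (11 / 8 : ℝ) ^ (3 * (L + 1)) := by
      rw [pow_mul]
      exact pow_le_pow_left₀ (by norm_num) (by norm_num) _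
    rw [hδ, ← div_eq_mul_one_div, le_div_iff₀ (by positivity)]
    linarith [h1, h2L']
  have h34 : 3 / 4 ≤ A^[3 * (L + 1)] p := by
    rw [min_eq_right hbig] at hph1; linarith
  have hmem := iterate_A_mem (3 * (L + 1)) (by linarith : (0 : ℝ) ≤ p) hp1
  -- phase 2
  have hph2 := iterate_A_phase2 (L + 3) h34 hmem.2
  have hlev : levels n = (L + 3) + 3 * (L + 1) := by rw [levels, hL]; ring
  rw [hlev, Function.iterate_add_apply]
  have h4n : 4 * n ≤ 2 ^ (L + 3) := by
    have : 2 ^ (L + 3) = 4 * 2 ^ (L + 1) := by ring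
    omega
  have hpow : (3 / 4 : ℝ) ^ (2 ^ (L + 3)) ≤ (1 / 2) ^ n :=
    calc (3 / 4 : ℝ) ^ (2 ^ (L + 3)) ≤ (3 / 4) ^ (4 * n) :=
          pow_le_pow_of_le_one (by norm_num) (by norm_num) h4n
      _ = ((3 / 4) ^ 4) ^ n := by rw [pow_mul]
      _ ≤ (1 / 2) ^ n := pow_le_pow_left₀ (by norm_num) (by norm_num) n
  linarith

/-! ### The `Maj₃` protocol gadget -/

/-- `Maj₃(p,q,r) = (p ∧ q) ∨ ((p ∨ q) ∧ r)`. -/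
def maj3 (p q r : Bool) : Bool := (p && q) || ((p || q) && r)

/-- The depth-`3` monotone KW protocol for `Maj₃(f,g,h)` on top of protocols for `f`, `g`, `h`:
Alice says whether `(f ∨ g) ∧ h` holds at her input; then Bob names a false conjunct; then (in the
`f ∨ g` branch) Alice names a true disjunct. -/
def majTree {ι : Type*} (f g h : (ι → Bool) → Bool) (P Q R : KWTree ι) : KWTree ι :=
  alice (fun x => (f x || g x) && h x) (bob (fun x => !g x) P Q)
    (bob (fun x => !h x) (alice g P Q) R)

theorem solvesMono_majTree {ι : Type*} {f g h : (ι → Bool) → Bool} {P Q R : KWTree ι}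
    (hP : P.SolvesMono f) (hQ : Q.SolvesMono g) (hR : R.SolvesMono h) :
    (majTree f g h P Q R).SolvesMono fun x => maj3 (f x) (g x) (h x) :=
  solvesMono_alice_or (solvesMono_bob_and hP hQ)
    (solvesMono_bob_and (solvesMono_alice_or hP hQ) hR)

theorem depth_majTree_le {ι : Type*} (f g h : (ι → Bool) → Bool) {P Q R : KWTree ι} {D : ℕ}
    (hP : P.depth ≤ D) (hQ : Q.depth ≤ D) (hR : R.depth ≤ D) :
    (majTree f g h P Q R).depth ≤ D + 3 := by
  simp only [majTree, depth_alice, depth_bob]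
  omega

/-! ### Exact counting for `Maj₃` of three independent seeds -/

section Counting

variable {T : Type*} [Fintype T] (P : T → Bool)

theorem sum_apply_bool (φ : Bool → ℕ) :
    ∑ ω, φ (P ω) = (univ.filter fun ω => P ω = true).card * φ true +
      (univ.filter fun ω => P ω = false).card * φ false := by
  rw [← Finset.sum_filter_add_sum_filter_not univ (fun ω => P ω = true)]
  have h1 : ∑ ω ∈ univ.filter (fun ω => P ω = true), φ (P ω) =
      ∑ _ω ∈ univ.filter (fun ω => P ω = true), φ true :=
    Finset.sum_congr rfl fun ω hω => by rw [(Finset.mem_filter.1 hω).2]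
  have h2 : ∑ ω ∈ univ.filter (fun ω => ¬P ω = true), φ (P ω) =
      ∑ _ω ∈ univ.filter (fun ω => P ω = false), φ false := by
    refine Finset.sum_congr (Finset.filter_congr fun ω _ => by simp) fun ω hω => ?_
    rw [(Finset.mem_filter.1 hω).2]
  rw [h1, h2, Finset.sum_const, Finset.sum_const, smul_eq_mul, smul_eq_mul]

theorem card_filter_true_add_false :
    (univ.filter fun ω => P ω = true).card + (univ.filter fun ω => P ω = false).card =
      Fintype.card T := by
  have := Finset.card_filter_add_card_filter_not (s := (univ : Finset T)) (fun ω => P ω = true)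
  rw [Finset.card_univ] at this
  convert this using 3
  ext ω; simp

/-- `#{(ω₁,ω₂,ω₃) : Maj₃(P ω₁, P ω₂, P ω₃)} = F³ + 3 F² F̄` with `F = #P⁻¹(1)`, `F̄ = #P⁻¹(0)`. -/
theorem card_filter_maj3 :
    (univ.filter fun ω : T × T × T => maj3 (P ω.1) (P ω.2.1) (P ω.2.2) = true).card =
      (univ.filter fun ω => P ω = true).card ^ 3 +
        3 * (univ.filter fun ω => P ω = true).card ^ 2 *
          (univ.filter fun ω => P ω = false).card := by
  set F := (univ.filter fun ω => P ω = true).card with hF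
  set Fb := (univ.filter fun ω => P ω = false).card with hFb
  rw [Finset.card_filter, Fintype.sum_prod_type]
  simp_rw [Fintype.sum_prod_type]
  have step3 : ∀ a b : T, ∑ c, (if maj3 (P a) (P b) (P c) = true then 1 else 0) =
      F * (if maj3 (P a) (P b) true = true then 1 else 0) +
        Fb * (if maj3 (P a) (P b) false = true then 1 else 0) := fun a b =>
    sum_apply_bool P fun z => if maj3 (P a) (P b) z = true then 1 else 0
  simp only [step3]
  have step2 : ∀ a : T, ∑ b, (F * (if maj3 (P a) (P b) true = true then 1 else 0) +
      Fb * (if maj3 (P a) (P b) false = true then 1 else 0)) =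
      F * (F * (if maj3 (P a) true true = true then 1 else 0) +
        Fb * (if maj3 (P a) true false = true then 1 else 0)) +
      Fb * (F * (if maj3 (P a) false true = true then 1 else 0) +
        Fb * (if maj3 (P a) false false = true then 1 else 0)) := fun a =>
    sum_apply_bool P fun y => F * (if maj3 (P a) y true = true then 1 else 0) +
      Fb * (if maj3 (P a) y false = true then 1 else 0)
  simp only [step2]
  rw [sum_apply_bool P fun x => F * (F * (if maj3 x true true = true then 1 else 0) +
        Fb * (if maj3 x true false = true then 1 else 0)) +
      Fb * (F * (if maj3 x false true = true then 1 else 0) +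
        Fb * (if maj3 x false false = true then 1 else 0))]
  simp [maj3]
  ring

/-- The same count as a real fraction: `A` of the fraction. -/
theorem frac_maj3 [Nonempty T] :
    ((univ.filter fun ω : T × T × T => maj3 (P ω.1) (P ω.2.1) (P ω.2.2) = true).card : ℝ) =
      Fintype.card (T × T × T) *
        A (((univ.filter fun ω => P ω = true).card : ℝ) / Fintype.card T) := by
  have hT : (0 : ℝ) < Fintype.card T := Nat.cast_pos.2 Fintype.card_pos
  have hsum := card_filter_true_add_false P
  have hFb : ((univ.filter fun ω => P ω = false).card : ℝ) =
      Fintype.card T - (univ.filter fun ω => P ω = true).card := by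
    rw [eq_sub_iff_add_eq]; exact_mod_cast (by rw [add_comm]; exact hsum)
  rw [card_filter_maj3, Fintype.card_prod, Fintype.card_prod]
  push_cast
  rw [hFb]
  unfold A
  field_simp
  ring

end Counting

/-! ### Virtual literals (padding with constants) and the level invariant -/

/-- Virtual literal universe: the `n` variables, `n + 1 - k` constants `1`, `k` constants `0`. -/
abbrev V (n k : ℕ) : Type := Fin n ⊕ (Fin (n + 1 - k) ⊕ Fin k)

/-- The padded assignment of a real input. -/
def virt (n k : ℕ) (x : Fin n → Bool) : V n k → Bool :=
  Sum.elim x (Sum.elim (fun _ => true) (fun _ => false))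

theorem card_V {n k : ℕ} (hk : k ≤ n + 1) : Fintype.card (V n k) = 2 * n + 1 := by
  simp only [V, Fintype.card_sum, Fintype.card_fin]
  omega

theorem card_virt (n k : ℕ) (x : Fin n → Bool) :
    (univ.filter fun v : V n k => virt n k x v = true).card = wt x + (n + 1 - k) := by
  rw [Finset.card_filter, Fintype.sum_sum_type, Fintype.sum_sum_type]
  have e1 : (∑ i : Fin n, if virt n k x (Sum.inl i) = true then 1 else 0) = wt x := by
    unfold wt; rw [Finset.card_filter]; rfl
  have e2 : (∑ c : Fin (n + 1 - k), if virt n k x (Sum.inr (Sum.inl c)) = true then 1 else 0) =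
      n + 1 - k := by
    have h : ∀ c : Fin (n + 1 - k),
        (if virt n k x (Sum.inr (Sum.inl c)) = true then 1 else 0) = 1 := fun _ => rfl
    simp only [h, Finset.sum_const, Finset.card_univ, Fintype.card_fin, smul_eq_mul, mul_one]
  have e3 : (∑ c : Fin k, if virt n k x (Sum.inr (Sum.inr c)) = true then 1 else 0) = 0 := by
    have h : ∀ c : Fin k, (if virt n k x (Sum.inr (Sum.inr c)) = true then 1 else 0) = 0 :=
      fun _ => rfl
    simp only [h, Finset.sum_const_zero]
  rw [e1, e2, e3, add_zero]

/-- Level-`j` invariant of Valiant's construction: a finite nonempty seed space `T`, for each seed a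
Boolean function of the virtual literals together with a monotone KW protocol of depth `≤ 3j` for
its pull-back to real inputs, whose acceptance count at every virtual assignment is EXACTLY
`|T| · A^{(j)}(fraction of true literals)`. -/
def LevelInv (n k j : ℕ) : Prop :=
  ∃ (T : Type) (_ : Fintype T) (_ : Nonempty T) (ev : T → (V n k → Bool) → Bool)
    (tr : T → KWTree (Fin n)),
    (∀ ω, (tr ω).depth ≤ 3 * j) ∧
    (∀ ω, (tr ω).SolvesMono fun x => ev ω (virt n k x)) ∧
    ∀ a : V n k → Bool, ((univ.filter fun ω => ev ω a = true).card : ℝ) =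
      Fintype.card T * A^[j] (((univ.filter fun v => a v = true).card : ℝ) / Fintype.card (V n k))

theorem levelInv_zero {n : ℕ} (k : ℕ) (hn : 1 ≤ n) : LevelInv n k 0 := by
  have hV : (0 : ℝ) < Fintype.card (V n k) := by
    have : Nonempty (V n k) := ⟨Sum.inl ⟨0, hn⟩⟩
    exact Nat.cast_pos.2 Fintype.card_pos
  refine ⟨V n k, inferInstance, ⟨Sum.inl ⟨0, hn⟩⟩, fun v a => a v,
    Sum.elim (fun i => leaf i) (fun _ => leaf ⟨0, hn⟩), fun ω => ?_, fun ω => ?_, fun a => ?_⟩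
  · rcases ω with i | c <;> simp
  · rcases ω with i | c | c
    · simpa [virt] using solvesMono_leaf (ι := Fin n) i
    · intro a b ha hb; simp [virt] at hb
    · intro a b ha hb; simp [virt] at ha
  · rw [Function.iterate_zero_apply, mul_div_cancel₀ _ hV.ne']

theorem levelInv_succ {n k j : ℕ} (h : LevelInv n k j) : LevelInv n k (j + 1) := by
  obtain ⟨T, _, _, ev, tr, hd, hs, hc⟩ := h
  refine ⟨T × T × T, inferInstance, inferInstance,
    fun ω a => maj3 (ev ω.1 a) (ev ω.2.1 a) (ev ω.2.2 a),
    fun ω => majTree (fun x => ev ω.1 (virt n k x)) (fun x => ev ω.2.1 (virt n k x))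
      (fun x => ev ω.2.2 (virt n k x)) (tr ω.1) (tr ω.2.1) (tr ω.2.2),
    fun ω => ?_, fun ω => ?_, fun a => ?_⟩
  · have := depth_majTree_le (fun x => ev ω.1 (virt n k x)) (fun x => ev ω.2.1 (virt n k x))
      (fun x => ev ω.2.2 (virt n k x)) (hd ω.1) (hd ω.2.1) (hd ω.2.2)
    omega
  · exact solvesMono_majTree (hs ω.1) (hs ω.2.1) (hs ω.2.2)
  · rw [frac_maj3 (fun ω => ev ω a), hc a, Function.iterate_succ_apply']
    have hT : (0 : ℝ) < Fintype.card T := Nat.cast_pos.2 Fintype.card_pos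
    rw [mul_div_cancel_left₀ _ hT.ne']

theorem levelInv_all {n : ℕ} (k : ℕ) (hn : 1 ≤ n) : ∀ j, LevelInv n k j
  | 0 => levelInv_zero k hn
  | j + 1 => levelInv_succ (levelInv_all k hn j)

/-! ### The theorem -/

theorem wt_le {n : ℕ} (x : Fin n → Bool) : wt x ≤ n := by
  unfold wt
  exact (Finset.card_filter_le _ _).trans (by simp)

/-- **Valiant 1984 / Karchmer 1989 Thm 4.1.1, protocol form (kernel-checked).** The monotone
Karchmer–Wigderson game of every threshold function `Th_k^n` (`n ≥ 1`) has a deterministic protocol of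
depth `≤ 18 (⌊log₂ n⌋ + 1)`.
[cite: Valiant1984, "Short monotone formulae for the majority function", J. Algorithms 5, Thm (depth
`5.3 log n`); exposition with `Maj₃`: Goldreich 2011/2020, "Valiant's polynomial-size monotone formula for
Majority"; Karchmer 1989 Thm 4.1.1] -/
theorem thresholdMonoLogDepth_holds : ThresholdMonoLogDepth := by
  refine ⟨18, fun n k hn => ?_⟩
  by_cases hk0 : k = 0
  · refine ⟨leaf ⟨0, hn⟩, by simp, fun a b _ hb => ?_⟩
    simp [thr, hk0] at hb
  by_cases hkn : n < k
  · refine ⟨leaf ⟨0, hn⟩, by simp, fun a b ha _ => ?_⟩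
    have := wt_le a
    simp [thr] at ha
    omega
  have hk1 : k ≤ n + 1 := by omega
  obtain ⟨T, _, _, ev, tr, hd, hs, hc⟩ := levelInv_all k hn (levels n)
  have hT : (0 : ℝ) < Fintype.card T := Nat.cast_pos.2 Fintype.card_pos
  have hVc : (Fintype.card (V n k) : ℝ) = 2 * n + 1 := by exact_mod_cast card_V hk1
  have hV0 : (0 : ℝ) < 2 * n + 1 := by positivity
  set p0 : ℝ := ((n : ℝ) + 1) / (2 * n + 1) with hp0
  have hp0le : p0 ≤ 1 := by rw [hp0, div_le_one hV0]; linarith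
  have hp0ge : 0 ≤ p0 := by positivity
  have hmain : 1 - A^[levels n] p0 ≤ 1 / 3 * (1 / 2) ^ n := iterate_A_levels le_rfl hp0le
  -- the fraction of accepting seeds at input x
  have hfrac : ∀ x : Fin n → Bool,
      ((univ.filter fun ω => ev ω (virt n k x) = true).card : ℝ) / Fintype.card T =
        A^[levels n] ((wt x + (n + 1 - k) : ℕ) / (2 * (n : ℝ) + 1)) := fun x => by
    rw [hc (virt n k x), card_virt, hVc, mul_div_cancel_left₀ _ hT.ne']
  obtain ⟨ω, hY, hN⟩ := exists_seed_of_frac (m := n) (fun ω x => ev ω (virt n k x))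
    (fun x => k ≤ wt x) (fun x => wt x < k) (fun x h1 h2 => absurd h1 (not_le.2 h2))
    (ε := 1 / 3 * (1 / 2) ^ n) (by positivity)
    (by rw [← mul_assoc, mul_comm ((2 : ℝ) ^ n), mul_assoc, ← mul_pow]; norm_num)
    (fun x hx => by
      show 1 - _ ≤ ((univ.filter fun ω => ev ω (virt n k x) = true).card : ℝ) / Fintype.card T
      rw [hfrac x]
      have hq : p0 ≤ ((wt x + (n + 1 - k) : ℕ) : ℝ) / (2 * (n : ℝ) + 1) := by
        rw [hp0]
        gcongr
        have : n + 1 ≤ wt x + (n + 1 - k) := by omega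
        exact_mod_cast this
      have hq1 : ((wt x + (n + 1 - k) : ℕ) : ℝ) / (2 * (n : ℝ) + 1) ≤ 1 := by
        rw [div_le_one hV0]
        have : wt x + (n + 1 - k) ≤ 2 * n + 1 := by have := wt_le x; omega
        exact_mod_cast this
      have := iterate_A_mono (levels n) hp0ge hq hq1
      linarith)
    (fun x hx => by
      show ((univ.filter fun ω => ev ω (virt n k x) = true).card : ℝ) / Fintype.card T ≤ _
      rw [hfrac x]
      have hq : ((wt x + (n + 1 - k) : ℕ) : ℝ) / (2 * (n : ℝ) + 1) ≤ 1 - p0 := by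
        have e : 1 - p0 = (n : ℝ) / (2 * n + 1) := by
          rw [hp0]; field_simp; ring
        rw [e]
        gcongr
        have : wt x + (n + 1 - k) ≤ n := by omega
        exact_mod_cast this
      have hq0 : 0 ≤ ((wt x + (n + 1 - k) : ℕ) : ℝ) / (2 * (n : ℝ) + 1) := by positivity
      have := iterate_A_mono (levels n) hq0 hq (by linarith)
      rw [iterate_A_symm] at this
      linarith)
  refine ⟨tr ω, ?_, ?_⟩
  · have := hd ω
    simp only [levels] at this
    omega
  · have hfun : (fun x => ev ω (virt n k x)) = thr n k := by
      funext x
      by_cases hx : k ≤ wt x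
      · rw [hY x hx]; simp [thr, hx]
      · rw [hN x (not_le.1 hx)]; simp [thr, hx]
    rw [← hfun]
    exact hs ω

/-- The UNGUARDED form (quantifying over `n = 0` too) is vacuously false: there is no protocol tree over
an empty coordinate type. -/
theorem isEmpty_kwTree_fin_zero : IsEmpty (KWTree (Fin 0)) := by
  refine ⟨fun P => ?_⟩
  induction P with
  | leaf i => exact i.elim0
  | alice _ _ _ ih _ => exact ih
  | bob _ _ _ ih _ => exact ih

theorem not_thresholdMonoLogDepth_unguarded :
    ¬ (∃ c : ℕ, ∀ n k : ℕ, ∃ T : KWTree (Fin n),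
        T.depth ≤ c * (Nat.log 2 n + 1) ∧ T.SolvesMono (thr n k)) := by
  rintro ⟨c, h⟩
  obtain ⟨T, -, -⟩ := h 0 0
  exact isEmpty_kwTree_fin_zero.false T


/-- **EMBED IMPLICATION, unconditional (v3).**  `SliceStrongComposition → StrongComposition`. -/
theorem strongComposition_of_sliceStrongComposition' (h0 : SliceStrongComposition) :
    Summit.PneNP.PneNP.Theses.KrwChromaticSteering.StrongComposition :=
  strongComposition_of_sliceStrongComposition thresholdMonoLogDepth_holds h0

/-- **EMBED IMPLICATION, fraction form, unconditional (v3).** -/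
theorem strongCompositionFrac_of_sliceStrongCompositionFrac' (h0 : SliceStrongCompositionFrac) :
    ∃ c k : ℕ, 0 < k ∧ ∀ m n : ℕ, 1 ≤ n → ∀ f : (Fin m → Bool) → Bool, (∃ a b, f a ≠ f b) →
      ∃ g : (Fin n → Bool) → Bool, ∀ P : KWTree (Fin m × Fin n), P.SolvesStrong f g →
        ∃ Q : KWTree (Fin m), Q.Solves f ∧ Q.depth + n / k ≤ P.depth + c * (Nat.log 2 (m * n) + 1) :=
  strongCompositionFrac_of_sliceStrongCompositionFrac thresholdMonoLogDepth_holds h0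

/-! ## § Converse at the fraction door — the Berkowitz doubling (v4, g5)

The card's Transfer paragraph said the converse `C1 → C₀` is "NOT cheap".  At the FRACTION DOOR it is
EXACT: Berkowitz's doubling `x ↦ (x, x̄, 1…1)` (the standard proof that slice functions have monotone
complexity within poly of their general complexity, Berkowitz 1982 / Wegener 1985 / "The Blue Book" §6.13)
embeds the strong game `KW_f ⊛ KW_g` on `n` columns into the ORIENTED strong game `KW_f ⊛ mKW_h` on
`N ∈ {2n, 2n+1}` columns for the `(N−n)`-slice `h(z) = g(z₁…zₙ)` on the layer, `0/1` off it; depth is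
preserved and the gain `N/(2k) = n/k` survives, so `StrongCompositionFrac(k) → SliceStrongCompositionFrac(2k)`.
Together with v3's orienter (`SliceStrongCompositionFrac(k) → StrongCompositionFrac(k)`) the slice host is
WLOG at the door: `StrongCompositionFrac ↔ SliceStrongCompositionFrac`, and C1 itself lands in C₀-frac. -/

/-- The inner-fraction door `StrongCompositionFrac` — verbatim body of
`InnerFractionDoor.StrongCompositionFrac` (card inner-fraction-door; that sketch module is not in the farm
build, so the statement is restated here and linked by `Iff.rfl`-level equality of bodies). -/
def StrongCompositionFrac : Prop :=
  ∃ c k : ℕ, 0 < k ∧ ∀ m n : ℕ, 1 ≤ n → ∀ f : (Fin m → Bool) → Bool, (∃ a b, f a ≠ f b) →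
    ∃ g : (Fin n → Bool) → Bool, ∀ P : KWTree (Fin m × Fin n), P.SolvesStrong f g →
      ∃ Q : KWTree (Fin m), Q.Solves f ∧ Q.depth + n / k ≤ P.depth + c * (Nat.log 2 (m * n) + 1)

/-- C1 is the door at `k = 1`. -/
theorem strongCompositionFrac_of_strongComposition
    (h : Summit.PneNP.PneNP.Theses.KrwChromaticSteering.StrongComposition) : StrongCompositionFrac := by
  obtain ⟨c, hc⟩ := h
  refine ⟨c, 1, Nat.one_pos, fun m n hn f hf => ?_⟩
  obtain ⟨g, hg⟩ := hc m n hn f hf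
  refine ⟨g, fun P hP => ?_⟩
  obtain ⟨Q, hQ, hd⟩ := hg P hP
  exact ⟨Q, hQ, by simpa using hd⟩

/-! ### The doubling `x ↦ (x, x̄, 1, …, 1)` -/

section Doubling

variable {m n N : ℕ}

/-- `dblNat n x J` = the `J`-th bit of `(x, x̄, 1, 1, …)`. -/
def dblNat (n : ℕ) (x : Fin n → Bool) (J : ℕ) : Bool :=
  if h₁ : J < n then x ⟨J, h₁⟩ else if h₂ : J < n + n then !(x ⟨J - n, by omega⟩) else true

/-- `dbl n N x = (x, x̄, 1, …, 1) ∈ {0,1}^N`. -/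
def dbl (n N : ℕ) (x : Fin n → Bool) : Fin N → Bool := fun J => dblNat n x J.val

/-- Folding a coordinate of `{0,1}^N` back onto `{0,1}^n` (`J ↦ J mod n`). -/
def fold (n N : ℕ) (hn : 0 < n) (J : Fin N) : Fin n := ⟨J.val % n, Nat.mod_lt _ hn⟩

/-- The slice extension of `g` at level `K`: `0` below, `1` above, `g` of the first `n` bits on it. -/
def sliceExt (K : ℕ) (hnN : n ≤ N) (g : (Fin n → Bool) → Bool) : (Fin N → Bool) → Bool := fun z =>
  if wt z < K then false else if K < wt z then true else g (z ∘ Fin.castLE hnN)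

theorem isSlice_sliceExt (K : ℕ) (hnN : n ≤ N) (g : (Fin n → Bool) → Bool) :
    IsSlice K (sliceExt K hnN g) := by
  intro z
  refine ⟨fun hz => by simp [sliceExt, hz], fun hz => ?_⟩
  have : ¬ wt z < K := Nat.lt_asymm hz
  simp [sliceExt, this, hz]

theorem dbl_comp_castLE (hnN : n ≤ N) (x : Fin n → Bool) : dbl n N x ∘ Fin.castLE hnN = x := by
  funext j
  simp [dbl, dblNat, j.isLt]

theorem wt_eq_sum {n : ℕ} (x : Fin n → Bool) : wt x = ∑ j : Fin n, (if x j = true then 1 else 0) := by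
  unfold wt
  rw [Finset.card_filter]

/-- The weight of `(x, x̄, 1…1)` is `N − n` (for `2n ≤ N`). -/
theorem wt_dbl (h2 : n + n ≤ N) (x : Fin n → Bool) : wt (dbl n N x) = N - n := by
  classical
  set b : ℕ → ℕ := fun J => if dblNat n x J = true then 1 else 0 with hb
  have h0 : wt (dbl n N x) = ∑ J ∈ range N, b J := by
    rw [wt_eq_sum]
    exact Fin.sum_univ_eq_sum_range (fun J => if dblNat n x J = true then 1 else 0) N
  have hsplit : ∑ J ∈ range N, b J =
      ∑ J ∈ Ico 0 n, b J + ∑ J ∈ Ico n (n + n), b J + ∑ J ∈ Ico (n + n) N, b J := by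
    rw [Finset.range_eq_Ico, Finset.sum_Ico_consecutive _ (Nat.zero_le n) (Nat.le_add_left n n),
      Finset.sum_Ico_consecutive _ (Nat.zero_le _) h2]
  have h1 : ∑ J ∈ Ico 0 n, b J = wt x := by
    rw [← Finset.range_eq_Ico, ← Fin.sum_univ_eq_sum_range, wt_eq_sum]
    refine Finset.sum_congr rfl fun j _ => ?_
    simp [hb, dblNat, j.isLt]
  have h2' : ∑ J ∈ Ico n (n + n), b J = ∑ j : Fin n, (if x j = false then 1 else 0) := by
    rw [Finset.sum_Ico_eq_sum_range, show n + n - n = n by omega, ← Fin.sum_univ_eq_sum_range]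
    refine Finset.sum_congr rfl fun j _ => ?_
    have hj : ¬ (n + (j : ℕ) < n) := by omega
    have hj' : n + (j : ℕ) < n + n := by omega
    simp [hb, dblNat, hj, hj']
  have h3 : ∑ J ∈ Ico (n + n) N, b J = N - (n + n) := by
    rw [Finset.sum_congr rfl (g := fun _ => 1), Finset.sum_const, Nat.card_Ico, smul_eq_mul, mul_one]
    intro J hJ
    rw [Finset.mem_Ico] at hJ
    have hJ1 : ¬ J < n := by omega
    have hJ2 : ¬ J < n + n := by omega
    simp [hb, dblNat, hJ1, hJ2]
  have h12 : wt x + ∑ j : Fin n, (if x j = false then 1 else 0) = n := by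
    rw [wt_eq_sum, ← Finset.sum_add_distrib]
    rw [Finset.sum_congr rfl (g := fun _ => 1), Finset.sum_const, Finset.card_univ, Fintype.card_fin,
      smul_eq_mul, mul_one]
    intro j _
    cases x j <;> simp
  rw [h0, hsplit, h1, h2', h3]
  omega

theorem sliceExt_dbl (h2 : n + n ≤ N) (hnN : n ≤ N) (g : (Fin n → Bool) → Bool) (x : Fin n → Bool) :
    sliceExt (N - n) hnN g (dbl n N x) = g x := by
  simp only [sliceExt, wt_dbl h2, lt_irrefl, if_false, dbl_comp_castLE]

/-- Decoding: a coordinate where the doubled vectors differ folds to one where the originals differ. -/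
theorem ne_fold_of_dbl_ne (hn : 0 < n) {x y : Fin n → Bool} {J : Fin N}
    (h : dbl n N x J ≠ dbl n N y J) : x (fold n N hn J) ≠ y (fold n N hn J) := by
  unfold dbl dblNat at h
  unfold fold
  by_cases h₁ : J.val < n
  · have hF : (⟨J.val % n, Nat.mod_lt _ hn⟩ : Fin n) = ⟨J.val, h₁⟩ := Fin.ext (Nat.mod_eq_of_lt h₁)
    rw [hF]
    simpa [h₁] using h
  · by_cases h₂ : J.val < n + n
    · have hmod : J.val % n = J.val - n := by
        rw [Nat.mod_eq_sub_mod (Nat.le_of_not_lt h₁)]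
        exact Nat.mod_eq_of_lt (by omega)
      have hF : (⟨J.val % n, Nat.mod_lt _ hn⟩ : Fin n) = ⟨J.val - n, by omega⟩ := Fin.ext hmod
      rw [hF]
      simp only [h₁, h₂, dite_false, dite_true, ne_eq, Bool.not_inj_iff] at h
      simpa using h
    · simp [h₁, h₂] at h

/-- Doubling every row of a matrix. -/
def dblRows (n N : ℕ) (X : Fin m × Fin n → Bool) : Fin m × Fin N → Bool := fun iJ =>
  dbl n N (row X iJ.1) iJ.2

theorem row_dblRows (X : Fin m × Fin n → Bool) (i : Fin m) : row (dblRows n N X) i = dbl n N (row X i) :=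
  rfl

theorem rowLabels_dblRows (h2 : n + n ≤ N) (hnN : n ≤ N) (g : (Fin n → Bool) → Bool)
    (X : Fin m × Fin n → Bool) : rowLabels (sliceExt (N - n) hnN g) (dblRows n N X) = rowLabels g X := by
  funext i
  simp only [rowLabels_apply, row_dblRows, sliceExt_dbl h2]

/-- **The embedding.** A protocol for the oriented strong game of `f` with the slice `sliceExt g` on `N`
columns, run on doubled rows and with its answer folded, solves the UNoriented strong game `KW_f ⊛ KW_g`. -/
theorem solvesStrong_comap_dblRows (hn : 0 < n) (h2 : n + n ≤ N) (hnN : n ≤ N)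
    {f : (Fin m → Bool) → Bool} {g : (Fin n → Bool) → Bool} {P : KWTree (Fin m × Fin N)}
    (hP : SolvesStrongMono P f (sliceExt (N - n) hnN g)) :
    (P.comap (dblRows n N) (dblRows n N) (fun iJ => (iJ.1, fold n N hn iJ.2))).SolvesStrong f g := by
  intro X Y hX hY
  have hX' : blockComp f (sliceExt (N - n) hnN g) (dblRows n N X) = true := by
    rw [blockComp_apply, rowLabels_dblRows h2]; rwa [blockComp_apply] at hX
  have hY' : blockComp f (sliceExt (N - n) hnN g) (dblRows n N Y) = false := by
    rw [blockComp_apply, rowLabels_dblRows h2]; rwa [blockComp_apply] at hY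
  obtain ⟨hlab, hXe, hYe⟩ := hP _ _ hX' hY'
  rw [rowLabels_dblRows h2, rowLabels_dblRows h2] at hlab
  rw [run_comap]
  refine ⟨?_, hlab⟩
  have hne : dblRows n N X (P.run (dblRows n N X) (dblRows n N Y)) ≠
      dblRows n N Y (P.run (dblRows n N X) (dblRows n N Y)) := by
    rw [hXe, hYe, rowLabels_dblRows h2, rowLabels_dblRows h2]; exact hlab
  exact ne_fold_of_dbl_ne hn hne

end Doubling

/-- **CONVERSE AT THE DOOR (kernel-checked).** `StrongCompositionFrac(c, k) → SliceStrongCompositionFrac(c, 2k)`: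
the inner function may be taken to be a SLICE function and the inner game ORIENTED, at the price of
halving the fraction.  (`N = 1`: the 1-slice `z ↦ z₀`, gain `1/(2k) = 0`, `Q` = `P` on constant rows.) -/
theorem sliceStrongCompositionFrac_of_strongCompositionFrac (h : StrongCompositionFrac) :
    SliceStrongCompositionFrac := by
  obtain ⟨c, k, hk, H⟩ := h
  refine ⟨c, 2 * k, by omega, fun m N hN f hf => ?_⟩
  rcases Nat.lt_or_ge N 2 with hN2 | hN2
  · obtain rfl : N = 1 := by omega
    refine ⟨1, fun z => z 0, fun z => ⟨fun hz => ?_, fun hz => absurd (wt_le z) (by omega)⟩,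
      fun P hP => ?_⟩
    · by_contra h0
      have : 0 < wt z := Finset.card_pos.mpr ⟨0, by simpa using h0⟩
      omega
    · refine ⟨P.comap (fun a iJ => a iJ.1) (fun a iJ => a iJ.1) Prod.fst, fun a b ha hb => ?_, ?_⟩
      · have hrl : ∀ a : Fin m → Bool,
            rowLabels (fun z : Fin 1 → Bool => z 0) (fun iJ : Fin m × Fin 1 => a iJ.1) = a := by
          intro a; funext i; simp
        have h := hP (fun iJ => a iJ.1) (fun iJ => b iJ.1) (by simpa [hrl] using ha)
          (by simpa [hrl] using hb)
        rw [run_comap]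
        simpa [hrl] using h.1
      · have : 1 / (2 * k) = 0 := Nat.div_eq_of_lt (by omega)
        simp only [depth_comap, this]
        omega
  · set n := N / 2 with hn_def
    have hn1 : 1 ≤ n := by omega
    have h2 : n + n ≤ N := by omega
    have hnN : n ≤ N := by omega
    obtain ⟨g, hg⟩ := H m n hn1 f hf
    refine ⟨N - n, sliceExt (N - n) hnN g, isSlice_sliceExt _ _ _, fun P hP => ?_⟩
    obtain ⟨Q, hQ, hd⟩ := hg _ (solvesStrong_comap_dblRows hn1 h2 hnN hP)
    refine ⟨Q, hQ, ?_⟩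
    rw [depth_comap] at hd
    have hdiv : N / (2 * k) = n / k := by rw [hn_def, Nat.div_div_eq_div_mul]
    have hlog : c * (Nat.log 2 (m * n) + 1) ≤ c * (Nat.log 2 (m * N) + 1) :=
      Nat.mul_le_mul_left c (Nat.add_le_add_right (Nat.log_mono_right (Nat.mul_le_mul_left m hnN)) 1)
    rw [hdiv]
    generalize n / k = q at hd ⊢
    generalize c * (Nat.log 2 (m * n) + 1) = L₁ at hd hlog
    generalize c * (Nat.log 2 (m * N) + 1) = L₂ at hlog ⊢
    omega

/-- `C1 → C₀-frac` (with `k₀ = 2`): the route's crux itself lands inside the slice host at the door. -/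
theorem sliceStrongCompositionFrac_of_strongComposition
    (h : Summit.PneNP.PneNP.Theses.KrwChromaticSteering.StrongComposition) : SliceStrongCompositionFrac :=
  sliceStrongCompositionFrac_of_strongCompositionFrac (strongCompositionFrac_of_strongComposition h)

/-! ## § The host, typed — dRMNPR's semi-monotone composition game and Conjecture 2

de Rezende–Meir–Nordström–Pitassi–Robere 2020 (arXiv:2007.02740), Definition 1 (p. 6): the SEMI-MONOTONE
composition `KW_f ⋄ mKW_g` of a non-constant `f` with a non-constant MONOTONE `g` — inputs `X, Y` with
`f(g(X)) = 1`, `f(g(Y)) = 0`; a valid answer `(i,j)` satisfies one of THREE options: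
`a_i > b_i ∧ X_ij > Y_ij`, `a_i < b_i ∧ X_ij < Y_ij`, `a_i = b_i ∧ X_ij ≠ Y_ij` (`a = g(X)`, `b = g(Y)`).
Options 1–2 together say `a_i ≠ b_i ∧ X_ij = a_i ∧ Y_ij = b_i` — exactly `SolvesStrongMono`; option 3 is the
extra freedom.  Conjecture 2 (ibid.): `C(KW_f ⋄ mKW_g) ≳ C(KW_f) + C(mKW_g)` for all such `f, g`; the paper
leaves `≳` informal — below are its two precise readings used on this crux (additive `O(log mn)` loss;
inner term at a constant fraction).  Theorem 1.2 there proves the `U_m`-outer analogue for lifted `g`. -/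

/-- dRMNPR Definition 1: `P` solves the semi-monotone composition game `KW_f ⋄ mKW_g`. -/
def SolvesSemiMono {m n : ℕ} (P : KWTree (Fin m × Fin n)) (f : (Fin m → Bool) → Bool)
    (g : (Fin n → Bool) → Bool) : Prop :=
  ∀ X Y : Fin m × Fin n → Bool, blockComp f g X = true → blockComp f g Y = false →
    (rowLabels g X (P.run X Y).1 ≠ rowLabels g Y (P.run X Y).1 ∧
        X (P.run X Y) = rowLabels g X (P.run X Y).1 ∧ Y (P.run X Y) = rowLabels g Y (P.run X Y).1) ∨
      (rowLabels g X (P.run X Y).1 = rowLabels g Y (P.run X Y).1 ∧ X (P.run X Y) ≠ Y (P.run X Y))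

/-- The oriented strong game is the semi-monotone game without option 3. -/
theorem SolvesStrongMono.semiMono {m n : ℕ} {P : KWTree (Fin m × Fin n)} {f : (Fin m → Bool) → Bool}
    {h : (Fin n → Bool) → Bool} (hP : SolvesStrongMono P f h) : SolvesSemiMono P f h :=
  fun X Y hX hY => Or.inl (hP X Y hX hY)

/-- A semi-monotone protocol is in particular a protocol for the standard game `KW_{f ⋄ g}`. -/
theorem SolvesSemiMono.solves {m n : ℕ} {P : KWTree (Fin m × Fin n)} {f : (Fin m → Bool) → Bool}
    {g : (Fin n → Bool) → Bool} (hP : SolvesSemiMono P f g) : P.Solves (blockComp f g) := by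
  intro X Y hX hY
  rcases hP X Y hX hY with ⟨hl, hXe, hYe⟩ | ⟨-, hne⟩
  · rw [hXe, hYe]; exact hl
  · exact hne

/-- **Conjecture 2 of dRMNPR 2020, additive reading** (`≳` = up to `c·(⌊log₂(mn)⌋+1)`), in relative form:
every semi-monotone protocol splits off a `KW_f` protocol and a monotone `KW_g` protocol. OPEN. -/
def SemiMonotoneKRW : Prop :=
  ∃ c : ℕ, ∀ m n : ℕ, 1 ≤ n → ∀ f : (Fin m → Bool) → Bool, (∃ a b, f a ≠ f b) →
    ∀ g : (Fin n → Bool) → Bool, Monotone g → (∃ u v, g u ≠ g v) →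
      ∀ P : KWTree (Fin m × Fin n), SolvesSemiMono P f g →
        ∃ Q : KWTree (Fin m), Q.Solves f ∧ ∃ R : KWTree (Fin n), R.SolvesMono g ∧
          Q.depth + R.depth ≤ P.depth + c * (Nat.log 2 (m * n) + 1)

/-- **Conjecture 2, fraction reading** (the inner term at a constant fraction `1/k`). OPEN; implied by the
additive reading (`k = 1`). -/
def SemiMonotoneKRWFrac : Prop :=
  ∃ c k : ℕ, 0 < k ∧ ∀ m n : ℕ, 1 ≤ n → ∀ f : (Fin m → Bool) → Bool, (∃ a b, f a ≠ f b) →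
    ∀ g : (Fin n → Bool) → Bool, Monotone g → (∃ u v, g u ≠ g v) →
      ∀ P : KWTree (Fin m × Fin n), SolvesSemiMono P f g →
        ∃ Q : KWTree (Fin m), Q.Solves f ∧ ∃ R : KWTree (Fin n), R.SolvesMono g ∧
          Q.depth + R.depth / k ≤ P.depth + c * (Nat.log 2 (m * n) + 1)

theorem semiMonotoneKRWFrac_of_semiMonotoneKRW (h : SemiMonotoneKRW) : SemiMonotoneKRWFrac := by
  obtain ⟨c, hc⟩ := h
  refine ⟨c, 1, Nat.one_pos, fun m n hn f hf g hg hg' P hP => ?_⟩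
  obtain ⟨Q, hQ, R, hR, hd⟩ := hc m n hn f hf g hg hg' P hP
  exact ⟨Q, hQ, R, hR, by simpa using hd⟩

/-! ### Slice functions are monotone; `Th_1^n` is a non-constant 1-slice -/

theorem wt_mono {n : ℕ} {x y : Fin n → Bool} (hxy : x ≤ y) : wt x ≤ wt y := by
  unfold wt
  refine Finset.card_le_card fun j hj => ?_
  simp only [Finset.mem_filter, Finset.mem_univ, true_and] at hj ⊢
  exact Bool.le_iff_imp.mp (hxy j) hj

theorem eq_of_le_of_wt_eq {n : ℕ} {x y : Fin n → Bool} (hxy : x ≤ y) (hw : wt x = wt y) : x = y := by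
  have hsub : (Finset.univ.filter fun j => x j = true) ⊆ (Finset.univ.filter fun j => y j = true) := by
    intro j hj
    simp only [Finset.mem_filter, Finset.mem_univ, true_and] at hj ⊢
    exact Bool.le_iff_imp.mp (hxy j) hj
  have heq := Finset.eq_of_subset_of_card_le hsub (by unfold wt at hw; rw [hw])
  funext j
  have hj : (x j = true) ↔ (y j = true) := by
    have := congrArg (fun s => j ∈ s) heq
    simpa using this
  cases hx : x j <;> cases hy : y j <;> simp_all

theorem IsSlice.monotone {n k : ℕ} {h : (Fin n → Bool) → Bool} (hs : IsSlice k h) : Monotone h := by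
  intro x y hxy
  have hw := wt_mono hxy
  rcases Nat.lt_or_ge (wt x) k with hx | hx
  · rw [(hs x).1 hx]; exact Bool.false_le _
  rcases Nat.lt_or_ge k (wt y) with hy | hy
  · rw [(hs y).2 hy]; exact Bool.le_true _
  have : x = y := eq_of_le_of_wt_eq hxy (by omega)
  rw [this]

theorem isSlice_thr (n k : ℕ) : IsSlice k (thr n k) := by
  intro x
  refine ⟨fun hx => by simp [thr]; omega, fun hx => by simp [thr]; omega⟩

theorem thr_one_nonconst {n : ℕ} (hn : 1 ≤ n) : ∃ u v, thr n 1 u ≠ thr n 1 v := by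
  refine ⟨fun _ => true, fun _ => false, ?_⟩
  have h1 : wt (fun _ : Fin n => true) = n := by simp [wt]
  have h0 : wt (fun _ : Fin n => false) = 0 := by simp [wt]
  simp [thr, h1, h0]
  omega

/-! ### Conjecture 2 ⟹ C₀ (given the rung P1), in both readings -/

/-- **HOST ⟹ C₀-frac.**  The fraction reading of dRMNPR's Conjecture 2, applied to the hard slice of P1
(`SliceMonoHardExist`, PROVED in `Cruxes/StrongComposition/SliceMonoHard.lean`:
`SliceMonoHard.sliceMonoHardExist_holds`, verbatim body), gives `SliceStrongCompositionFrac` — hence (v3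
orienter) the inner-fraction door, and (`CompositionIterationFrac`) `P ⊄ NC¹`. -/
theorem sliceStrongCompositionFrac_of_semiMonotoneKRWFrac (hP1 : SliceMonoHardExist)
    (hC : SemiMonotoneKRWFrac) : SliceStrongCompositionFrac := by
  obtain ⟨c₁, hP1⟩ := hP1
  obtain ⟨c, k, hk, hC⟩ := hC
  refine ⟨c + c₁ + 1, k, hk, fun m n hn f hf => ?_⟩
  obtain ⟨k₁, h, hs, hh⟩ := hP1 n hn
  have hm : 1 ≤ m := one_le_of_nonconst hf
  have hlog : Nat.log 2 n ≤ Nat.log 2 (m * n) := Nat.log_mono_right (Nat.le_mul_of_pos_left n hm)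
  by_cases hnc : ∃ u v, h u ≠ h v
  · -- the hard slice is non-constant: use it as the inner function
    refine ⟨k₁, h, hs, fun P hP => ?_⟩
    obtain ⟨Q, hQ, R, hR, hd⟩ := hC m n hn f hf h hs.monotone hnc P hP.semiMono
    refine ⟨Q, hQ, ?_⟩
    have hn_le : n ≤ R.depth + c₁ * (Nat.log 2 n + 1) := hh R hR
    have h1 : n / k ≤ R.depth / k + c₁ * (Nat.log 2 (m * n) + 1) := by
      calc n / k ≤ (R.depth + (c₁ * (Nat.log 2 (m * n) + 1)) * k) / k := by
            apply Nat.div_le_div_right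
            calc n ≤ R.depth + c₁ * (Nat.log 2 n + 1) := hn_le
              _ ≤ R.depth + c₁ * (Nat.log 2 (m * n) + 1) := by
                  have := Nat.mul_le_mul_left c₁ (Nat.add_le_add_right hlog 1); omega
              _ ≤ R.depth + (c₁ * (Nat.log 2 (m * n) + 1)) * k := by
                  have := Nat.le_mul_of_pos_right (c₁ * (Nat.log 2 (m * n) + 1)) hk; omega
        _ = R.depth / k + c₁ * (Nat.log 2 (m * n) + 1) := Nat.add_mul_div_right _ _ hk
    have hsplit : (c + c₁ + 1) * (Nat.log 2 (m * n) + 1) =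
        c * (Nat.log 2 (m * n) + 1) + c₁ * (Nat.log 2 (m * n) + 1) + (Nat.log 2 (m * n) + 1) := by ring
    rw [hsplit]
    generalize n / k = q at h1 ⊢
    generalize R.depth / k = r at hd h1
    generalize c * (Nat.log 2 (m * n) + 1) = L at hd ⊢
    generalize c₁ * (Nat.log 2 (m * n) + 1) = L₁ at h1 ⊢
    omega
  · -- the hard slice is constant: then `n = O(log n)` and `Th_1^n` (the `n`-bit OR) will do
    push Not at hnc
    have hsmall : n ≤ c₁ * (Nat.log 2 n + 1) := by
      have h0 := hh (leaf ⟨0, hn⟩) (fun a b ha hb => absurd ((hnc a b).symm.trans ha) (by rw [hb]; decide))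
      simpa using h0
    refine ⟨1, thr n 1, isSlice_thr n 1, fun P hP => ?_⟩
    obtain ⟨Q, hQ, R, -, hd⟩ :=
      hC m n hn f hf (thr n 1) (isSlice_thr n 1).monotone (thr_one_nonconst hn) P hP.semiMono
    refine ⟨Q, hQ, ?_⟩
    have h1 : n / k ≤ c₁ * (Nat.log 2 (m * n) + 1) :=
      (Nat.div_le_self n k).trans (hsmall.trans (Nat.mul_le_mul_left c₁ (by omega)))
    have hsplit : (c + c₁ + 1) * (Nat.log 2 (m * n) + 1) =
        c * (Nat.log 2 (m * n) + 1) + c₁ * (Nat.log 2 (m * n) + 1) + (Nat.log 2 (m * n) + 1) := by ring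
    rw [hsplit]
    generalize n / k = q at h1 ⊢
    generalize R.depth / k = r at hd
    generalize c * (Nat.log 2 (m * n) + 1) = L at hd ⊢
    generalize c₁ * (Nat.log 2 (m * n) + 1) = L₁ at h1 ⊢
    omega

/-- **HOST ⟹ C₀ (additive reading).** -/
theorem sliceStrongComposition_of_semiMonotoneKRW (hP1 : SliceMonoHardExist) (hC : SemiMonotoneKRW) :
    SliceStrongComposition := by
  obtain ⟨c₁, hP1⟩ := hP1
  obtain ⟨c, hC⟩ := hC
  refine ⟨c + c₁ + 1, fun m n hn f hf => ?_⟩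
  obtain ⟨k₁, h, hs, hh⟩ := hP1 n hn
  have hm : 1 ≤ m := one_le_of_nonconst hf
  have hlog : Nat.log 2 n ≤ Nat.log 2 (m * n) := Nat.log_mono_right (Nat.le_mul_of_pos_left n hm)
  have hlog' : c₁ * (Nat.log 2 n + 1) ≤ c₁ * (Nat.log 2 (m * n) + 1) :=
    Nat.mul_le_mul_left c₁ (Nat.add_le_add_right hlog 1)
  have hsplit : (c + c₁ + 1) * (Nat.log 2 (m * n) + 1) =
      c * (Nat.log 2 (m * n) + 1) + c₁ * (Nat.log 2 (m * n) + 1) + (Nat.log 2 (m * n) + 1) := by ring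
  by_cases hnc : ∃ u v, h u ≠ h v
  · refine ⟨k₁, h, hs, fun P hP => ?_⟩
    obtain ⟨Q, hQ, R, hR, hd⟩ := hC m n hn f hf h hs.monotone hnc P hP.semiMono
    refine ⟨Q, hQ, ?_⟩
    have hn_le : n ≤ R.depth + c₁ * (Nat.log 2 n + 1) := hh R hR
    rw [hsplit]
    generalize c * (Nat.log 2 (m * n) + 1) = L at hd ⊢
    generalize c₁ * (Nat.log 2 (m * n) + 1) = L₁ at hlog' ⊢
    generalize c₁ * (Nat.log 2 n + 1) = L₂ at hn_le hlog'
    omega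
  · push Not at hnc
    have hsmall : n ≤ c₁ * (Nat.log 2 n + 1) := by
      have h0 := hh (leaf ⟨0, hn⟩) (fun a b ha hb => absurd ((hnc a b).symm.trans ha) (by rw [hb]; decide))
      simpa using h0
    refine ⟨1, thr n 1, isSlice_thr n 1, fun P hP => ?_⟩
    obtain ⟨Q, hQ, R, -, hd⟩ :=
      hC m n hn f hf (thr n 1) (isSlice_thr n 1).monotone (thr_one_nonconst hn) P hP.semiMono
    refine ⟨Q, hQ, ?_⟩
    rw [hsplit]
    generalize c * (Nat.log 2 (m * n) + 1) = L at hd ⊢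
    generalize c₁ * (Nat.log 2 (m * n) + 1) = L₁ at hlog' ⊢
    generalize c₁ * (Nat.log 2 n + 1) = L₂ at hsmall hlog'
    omega

/-! ### Status at the door (v4 summary)

`StrongComposition →[k:=1] StrongCompositionFrac ↔ SliceStrongCompositionFrac ←[P1] SemiMonotoneKRWFrac ← SemiMonotoneKRW`
and `SliceStrongComposition → StrongComposition` (v3), `SemiMonotoneKRW →[P1] SliceStrongComposition`. -/

/-- **THE SLICE HOST IS WLOG AT THE DOOR (kernel-checked).** The inner-fraction door is EQUIVALENT to its
slice / oriented form: `StrongCompositionFrac ↔ SliceStrongCompositionFrac` (→ Berkowitz doubling, `k ↦ 2k`;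
← the v3 orienter with Valiant's threshold protocols, same `k`). -/
theorem strongCompositionFrac_iff_sliceStrongCompositionFrac :
    StrongCompositionFrac ↔ SliceStrongCompositionFrac :=
  ⟨sliceStrongCompositionFrac_of_strongCompositionFrac, fun h0 =>
    strongCompositionFrac_of_sliceStrongCompositionFrac' h0⟩

/-- **HOST ⟹ DOOR.** dRMNPR Conjecture 2 (fraction reading) and the proved rung P1 give the
inner-fraction door `StrongCompositionFrac` — which decides the sub-problem through `closes_frac` once
`CompositionIterationFrac` is supplied (typed and PROVED in `Cruxes/StrongComposition/CompositionIterationFrac.lean`, g5). -/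
theorem strongCompositionFrac_of_semiMonotoneKRWFrac (hP1 : SliceMonoHardExist)
    (hC : SemiMonotoneKRWFrac) : StrongCompositionFrac :=
  strongCompositionFrac_of_sliceStrongCompositionFrac'
    (sliceStrongCompositionFrac_of_semiMonotoneKRWFrac hP1 hC)

/-- **HOST ⟹ CRUX (additive reading).** dRMNPR Conjecture 2 with additive `O(log mn)` loss and P1 give the
route's crux C1 itself. -/
theorem strongComposition_of_semiMonotoneKRW (hP1 : SliceMonoHardExist) (hC : SemiMonotoneKRW) :
    Summit.PneNP.PneNP.Theses.KrwChromaticSteering.StrongComposition :=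
  strongComposition_of_sliceStrongComposition' (sliceStrongComposition_of_semiMonotoneKRW hP1 hC)

/-! ## § Direct — the host conjecture decides weak KRW (v5, g5): no strong game, no C2

For a slice inner function `h`, a leaf `(i,j)` of a STANDARD protocol for `KW_{f ⋄ h}` knows only
`X_{ij} ≠ Y_{ij}`.  Two more bits (`a_i = h(X_i)` from Alice, `b_i = h(Y_i)` from Bob) sort the leaf into
dRMNPR's options: equal labels — option 3, stop; different labels — the Berkowitz–Valiant orienter of
§ orienter inside row `i` (`O(log n)` bits).  So against a SLICE inner function, standard protocols and
semi-monotone protocols have the same power up to `O(log n)`, and Conjecture 2 (which splits every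
semi-monotone protocol into a `KW_f` part and an `mKW_h` part) plus the hard slice of P1 yields the weak KRW
conjecture in depth form — the hypothesis of the landed S3 `CompositionIteration_proof`. -/

section Direct

variable {m n : ℕ}

/-- The semi-monotone orienter grafted at a leaf `(i,j)` of a standard protocol: Alice announces `a_i`, Bob
announces `b_i`; on equal labels the entry `(i,j)` is a valid option-3 answer; on different labels the entry is
oriented exactly as in `orient`. -/
def orientSemi (h : (Fin n → Bool) → Bool) (T : KWTree (Fin n)) (ij : Fin m × Fin n) :
    KWTree (Fin m × Fin n) :=
  KWTree.alice (fun X => rowLabels h X ij.1)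
    (KWTree.bob (fun Y => rowLabels h Y ij.1)
      (KWTree.leaf ij)
      (KWTree.alice (fun X => X ij) (KWTree.leaf ij) (fixF T ij.1 ij.2)))
    (KWTree.bob (fun Y => rowLabels h Y ij.1)
      (KWTree.alice (fun X => X ij) (fixT T ij.1 ij.2) (KWTree.leaf ij))
      (KWTree.leaf ij))

theorem depth_orientSemi (h : (Fin n → Bool) → Bool) (T : KWTree (Fin n)) (ij : Fin m × Fin n) :
    (orientSemi h T ij).depth = T.depth + 3 := by
  simp [orientSemi]

/-- **The semi-monotone orienter is correct**: grafted under a standard protocol for `KW_{f ⋄ h}`, `h` a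
`k`-slice, with a monotone threshold protocol `T` for `Th_k^n`, it solves dRMNPR's semi-monotone game. -/
theorem solvesSemiMono_graft_orientSemi {k : ℕ} {f : (Fin m → Bool) → Bool}
    {h : (Fin n → Bool) → Bool} {T : KWTree (Fin n)} {P : KWTree (Fin m × Fin n)}
    (hs : IsSlice k h) (hT : T.SolvesMono (thr n k)) (hP : P.Solves (blockComp f h)) :
    SolvesSemiMono (graft P (orientSemi h T)) f h := by
  intro X Y hX hY
  have hne := hP X Y hX hY
  rw [run_graft]
  generalize hij : P.run X Y = ij at hne
  obtain ⟨i, j⟩ := ij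
  have hy := eq_not_of_ne hne
  cases ha : h (row X i) <;> cases hb : h (row Y i) <;> cases hx : X (i, j) <;>
    simp only [hx, Bool.not_false, Bool.not_true] at hy
  · -- a_i = b_i = 0, option 3
    simp [orientSemi, rowLabels, ha, hb, hx, hy]
  · simp [orientSemi, rowLabels, ha, hb, hx, hy]
  · -- a_i = 0, b_i = 1, X_ij = 0, Y_ij = 1 : already oriented
    simp [orientSemi, rowLabels, ha, hb, hx, hy]
  · -- a_i = 0, b_i = 1, X_ij = 1, Y_ij = 0 : Bob holds the heavy row
    have hwy : k ≤ wt (row Y i) := le_wt_of_true hs hb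
    have hwx : wt (row X i) ≤ k := wt_le_of_false hs ha
    obtain ⟨h1, h2⟩ := thr_sep hwy hwx (show row X i j = true by simpa using hx)
    obtain ⟨hT1, hT2⟩ := hT _ _ h1 h2
    set j' := T.run (row Y i) (Function.update (row X i) j false) with hj'
    have hjj : j' ≠ j := by
      rintro hjj
      rw [hjj] at hT1
      simp [hy] at hT1
    have hX' : X (i, j') = false := by
      simpa [Function.update_of_ne hjj] using hT2
    have hY' : Y (i, j') = true := by simpa using hT1
    simp [orientSemi, rowLabels, ha, hb, hx, ← hj', hX', hY']
  · -- a_i = 1, b_i = 0, X_ij = 0, Y_ij = 1 : Alice holds the heavy row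
    have hwx : k ≤ wt (row X i) := le_wt_of_true hs ha
    have hwy : wt (row Y i) ≤ k := wt_le_of_false hs hb
    obtain ⟨h1, h2⟩ := thr_sep hwx hwy (show row Y i j = true by simpa using hy)
    obtain ⟨hT1, hT2⟩ := hT _ _ h1 h2
    set j' := T.run (row X i) (Function.update (row Y i) j false) with hj'
    have hjj : j' ≠ j := by
      rintro hjj
      rw [hjj] at hT1
      simp [hx] at hT1
    have hY' : Y (i, j') = false := by
      simpa [Function.update_of_ne hjj] using hT2
    have hX' : X (i, j') = true := by simpa using hT1
    simp [orientSemi, rowLabels, ha, hb, hx, ← hj', hX', hY']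
  · -- a_i = 1, b_i = 0, X_ij = 1, Y_ij = 0 : already oriented
    simp [orientSemi, rowLabels, ha, hb, hx, hy]
  · -- a_i = b_i = 1, option 3
    simp [orientSemi, rowLabels, ha, hb, hx, hy]
  · simp [orientSemi, rowLabels, ha, hb, hx, hy]

end Direct

/-- **Weak KRW, depth form** — VERBATIM the hypothesis of the route decl `CompositionIteration`
(`Theses/KrwChromaticSteering.lean`), whose consequent `∃ L ∈ P, L ∉ NC¹` is the landed
`Summit.PneNP.PneNP.Theorems.CompositionIteration_proof`.  OPEN (it is the weak KRW conjecture). -/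
def WeakKRW : Prop :=
  ∃ c : ℕ, ∀ m n : ℕ, 1 ≤ n → ∀ f : (Fin m → Bool) → Bool, (∃ a b, f a ≠ f b) →
    ∃ g : (Fin n → Bool) → Bool, ∀ P : KWTree (Fin m × Fin n), P.Solves (blockComp f g) →
      ∃ Q : KWTree (Fin m), Q.Solves f ∧ Q.depth + n ≤ P.depth + c * (Nat.log 2 (m * n) + 1)

/-- Weak KRW with the inner term at a constant fraction — VERBATIM `CompositionIterationFrac.WeakKRWFrac`
(`Cruxes/StrongComposition/CompositionIterationFrac.lean`, where `WeakKRWFrac → ∃ L ∈ P, L ∉ NC¹` is PROVED,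
`compositionIterationFrac_holds`).  OPEN. -/
def WeakKRWFrac : Prop :=
  ∃ c k : ℕ, 0 < k ∧ ∀ m n : ℕ, 1 ≤ n → ∀ f : (Fin m → Bool) → Bool, (∃ a b, f a ≠ f b) →
    ∃ g : (Fin n → Bool) → Bool, ∀ P : KWTree (Fin m × Fin n), P.Solves (blockComp f g) →
      ∃ Q : KWTree (Fin m), Q.Solves f ∧ Q.depth + n / k ≤ P.depth + c * (Nat.log 2 (m * n) + 1)

/-- VERBATIM `CompositionIterationFrac.CompositionIterationFrac` (PROVED there; restated because crux
workfiles do not import one another). -/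
def CompositionIterationFrac : Prop :=
  WeakKRWFrac → ∃ L ∈ Classes.P, L ∉ NC1

/-- **Weak KRW in the host's language**: a SLICE inner witness, and the lower bound demanded only of
protocols for dRMNPR's SEMI-MONOTONE game. -/
def SliceSemiMonoWeakKRW : Prop :=
  ∃ c : ℕ, ∀ m n : ℕ, 1 ≤ n → ∀ f : (Fin m → Bool) → Bool, (∃ a b, f a ≠ f b) →
    ∃ k : ℕ, ∃ h : (Fin n → Bool) → Bool, IsSlice k h ∧
      ∀ P : KWTree (Fin m × Fin n), SolvesSemiMono P f h →
        ∃ Q : KWTree (Fin m), Q.Solves f ∧ Q.depth + n ≤ P.depth + c * (Nat.log 2 (m * n) + 1)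

/-- The same at a constant fraction of the inner term. -/
def SliceSemiMonoWeakKRWFrac : Prop :=
  ∃ c k₀ : ℕ, 0 < k₀ ∧ ∀ m n : ℕ, 1 ≤ n → ∀ f : (Fin m → Bool) → Bool, (∃ a b, f a ≠ f b) →
    ∃ k : ℕ, ∃ h : (Fin n → Bool) → Bool, IsSlice k h ∧
      ∀ P : KWTree (Fin m × Fin n), SolvesSemiMono P f h →
        ∃ Q : KWTree (Fin m), Q.Solves f ∧ Q.depth + n / k₀ ≤ P.depth + c * (Nat.log 2 (m * n) + 1)

theorem sliceSemiMonoWeakKRWFrac_of_sliceSemiMonoWeakKRW (h : SliceSemiMonoWeakKRW) :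
    SliceSemiMonoWeakKRWFrac := by
  obtain ⟨c, hc⟩ := h
  refine ⟨c, 1, Nat.one_pos, fun m n hn f hf => ?_⟩
  obtain ⟨k, g, hs, hg⟩ := hc m n hn f hf
  refine ⟨k, g, hs, fun P hP => ?_⟩
  obtain ⟨Q, hQ, hd⟩ := hg P hP
  exact ⟨Q, hQ, by simpa using hd⟩

/-! ### Semi-monotone protocols suffice (the orienter direction) -/

/-- **Host language ⟹ weak KRW**, parametric in the threshold protocols. -/
theorem weakKRW_of_sliceSemiMonoWeakKRW (hT : ThresholdMonoLogDepth) (h0 : SliceSemiMonoWeakKRW) :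
    WeakKRW := by
  obtain ⟨cT, hcT⟩ := hT
  obtain ⟨c0, hc0⟩ := h0
  refine ⟨c0 + cT + 3, fun m n hn f hf => ?_⟩
  obtain ⟨k, h, hs, hh⟩ := hc0 m n hn f hf
  obtain ⟨T, hTd, hTs⟩ := hcT n k hn
  refine ⟨h, fun P hP => ?_⟩
  obtain ⟨Q, hQ, hQd⟩ := hh (graft P (orientSemi h T)) (solvesSemiMono_graft_orientSemi hs hTs hP)
  refine ⟨Q, hQ, ?_⟩
  have hdep : (graft P (orientSemi h T)).depth ≤ P.depth + (T.depth + 3) :=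
    depth_graft_le _ _ (fun ij => (depth_orientSemi h T ij).le) P
  have hm : 1 ≤ m := one_le_of_nonconst hf
  have hlog : Nat.log 2 n ≤ Nat.log 2 (m * n) := Nat.log_mono_right (Nat.le_mul_of_pos_left n hm)
  have hT' : T.depth ≤ cT * (Nat.log 2 (m * n) + 1) :=
    hTd.trans (Nat.mul_le_mul_left _ (by omega))
  have hsplit : (c0 + cT + 3) * (Nat.log 2 (m * n) + 1) =
      c0 * (Nat.log 2 (m * n) + 1) + cT * (Nat.log 2 (m * n) + 1) + 3 * (Nat.log 2 (m * n) + 1) := by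
    ring
  rw [hsplit]
  omega

theorem weakKRWFrac_of_sliceSemiMonoWeakKRWFrac (hT : ThresholdMonoLogDepth)
    (h0 : SliceSemiMonoWeakKRWFrac) : WeakKRWFrac := by
  obtain ⟨cT, hcT⟩ := hT
  obtain ⟨c0, k₀, hk₀, hc0⟩ := h0
  refine ⟨c0 + cT + 3, k₀, hk₀, fun m n hn f hf => ?_⟩
  obtain ⟨k, h, hs, hh⟩ := hc0 m n hn f hf
  obtain ⟨T, hTd, hTs⟩ := hcT n k hn
  refine ⟨h, fun P hP => ?_⟩
  obtain ⟨Q, hQ, hQd⟩ := hh (graft P (orientSemi h T)) (solvesSemiMono_graft_orientSemi hs hTs hP)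
  refine ⟨Q, hQ, ?_⟩
  have hdep : (graft P (orientSemi h T)).depth ≤ P.depth + (T.depth + 3) :=
    depth_graft_le _ _ (fun ij => (depth_orientSemi h T ij).le) P
  have hm : 1 ≤ m := one_le_of_nonconst hf
  have hlog : Nat.log 2 n ≤ Nat.log 2 (m * n) := Nat.log_mono_right (Nat.le_mul_of_pos_left n hm)
  have hT' : T.depth ≤ cT * (Nat.log 2 (m * n) + 1) :=
    hTd.trans (Nat.mul_le_mul_left _ (by omega))
  have hsplit : (c0 + cT + 3) * (Nat.log 2 (m * n) + 1) =
      c0 * (Nat.log 2 (m * n) + 1) + cT * (Nat.log 2 (m * n) + 1) + 3 * (Nat.log 2 (m * n) + 1) := by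
    ring
  rw [hsplit]
  generalize n / k₀ = q at hQd ⊢
  omega

/-- Unconditional forms (Valiant's threshold protocols are proved in § Valiant). -/
theorem weakKRW_of_sliceSemiMonoWeakKRW' (h0 : SliceSemiMonoWeakKRW) : WeakKRW :=
  weakKRW_of_sliceSemiMonoWeakKRW thresholdMonoLogDepth_holds h0

theorem weakKRWFrac_of_sliceSemiMonoWeakKRWFrac' (h0 : SliceSemiMonoWeakKRWFrac) : WeakKRWFrac :=
  weakKRWFrac_of_sliceSemiMonoWeakKRWFrac thresholdMonoLogDepth_holds h0

/-! ### The doubling direction: weak KRW ⟹ its host-language form (fraction scale) -/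

section DoublingStd

variable {m n N : ℕ}

/-- A standard protocol for `f ⋄ sliceExt g` on doubled rows, with its answer folded, is a standard protocol
for `f ⋄ g`. -/
theorem solves_comap_dblRows (hn : 0 < n) (h2 : n + n ≤ N) (hnN : n ≤ N)
    {f : (Fin m → Bool) → Bool} {g : (Fin n → Bool) → Bool} {P : KWTree (Fin m × Fin N)}
    (hP : P.Solves (blockComp f (sliceExt (N - n) hnN g))) :
    (P.comap (dblRows n N) (dblRows n N) (fun iJ => (iJ.1, fold n N hn iJ.2))).Solves (blockComp f g) := by
  intro X Y hX hY
  have hX' : blockComp f (sliceExt (N - n) hnN g) (dblRows n N X) = true := by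
    rw [blockComp_apply, rowLabels_dblRows h2]; rwa [blockComp_apply] at hX
  have hY' : blockComp f (sliceExt (N - n) hnN g) (dblRows n N Y) = false := by
    rw [blockComp_apply, rowLabels_dblRows h2]; rwa [blockComp_apply] at hY
  have hne := hP _ _ hX' hY'
  rw [run_comap]
  exact ne_fold_of_dbl_ne hn hne

end DoublingStd

/-- **weak KRW(c, k) ⟹ host-language weak KRW(c, 2k)** by Berkowitz's doubling: the inner witness becomes the
slice `sliceExt g` on `N ∈ {2n, 2n+1}` columns, and a semi-monotone protocol for it is in particular a standard
one, which folds to a standard protocol for `f ⋄ g`.  (`N = 1`: the 1-slice `z ↦ z₀`, gain `1/(2k) = 0`.) -/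
theorem sliceSemiMonoWeakKRWFrac_of_weakKRWFrac (h : WeakKRWFrac) : SliceSemiMonoWeakKRWFrac := by
  obtain ⟨c, k, hk, H⟩ := h
  refine ⟨c, 2 * k, by omega, fun m N hN f hf => ?_⟩
  rcases Nat.lt_or_ge N 2 with hN2 | hN2
  · obtain rfl : N = 1 := by omega
    refine ⟨1, fun z => z 0, fun z => ⟨fun hz => ?_, fun hz => absurd (wt_le z) (by omega)⟩,
      fun P hP => ?_⟩
    · by_contra h0
      have : 0 < wt z := Finset.card_pos.mpr ⟨0, by simpa using h0⟩
      omega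
    · refine ⟨P.comap (fun a iJ => a iJ.1) (fun a iJ => a iJ.1) Prod.fst, fun a b ha hb => ?_, ?_⟩
      · have hrl : ∀ a : Fin m → Bool,
            rowLabels (fun z : Fin 1 → Bool => z 0) (fun iJ : Fin m × Fin 1 => a iJ.1) = a := by
          intro a; funext i; simp
        have h := hP.solves (fun iJ => a iJ.1) (fun iJ => b iJ.1) (by simpa [hrl] using ha)
          (by simpa [hrl] using hb)
        rw [run_comap]
        simpa using h
      · have : 1 / (2 * k) = 0 := Nat.div_eq_of_lt (by omega)
        simp only [depth_comap, this]
        omega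
  · set n := N / 2 with hn_def
    have hn1 : 1 ≤ n := by omega
    have h2 : n + n ≤ N := by omega
    have hnN : n ≤ N := by omega
    obtain ⟨g, hg⟩ := H m n hn1 f hf
    refine ⟨N - n, sliceExt (N - n) hnN g, isSlice_sliceExt _ _ _, fun P hP => ?_⟩
    obtain ⟨Q, hQ, hd⟩ := hg _ (solves_comap_dblRows hn1 h2 hnN hP.solves)
    refine ⟨Q, hQ, ?_⟩
    rw [depth_comap] at hd
    have hdiv : N / (2 * k) = n / k := by rw [hn_def, Nat.div_div_eq_div_mul]
    have hlog : c * (Nat.log 2 (m * n) + 1) ≤ c * (Nat.log 2 (m * N) + 1) :=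
      Nat.mul_le_mul_left c (Nat.add_le_add_right (Nat.log_mono_right (Nat.mul_le_mul_left m hnN)) 1)
    rw [hdiv]
    generalize n / k = q at hd ⊢
    generalize c * (Nat.log 2 (m * n) + 1) = L₁ at hd hlog
    generalize c * (Nat.log 2 (m * N) + 1) = L₂ at hlog ⊢
    omega

/-- **AT THE FRACTION SCALE THE HOST'S LANGUAGE IS WLOG FOR WEAK KRW (kernel-checked):** weak KRW with
fractional gain ⟺ weak KRW with a SLICE witness demanded only of SEMI-MONOTONE protocols. -/
theorem weakKRWFrac_iff_sliceSemiMonoWeakKRWFrac : WeakKRWFrac ↔ SliceSemiMonoWeakKRWFrac :=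
  ⟨sliceSemiMonoWeakKRWFrac_of_weakKRWFrac, weakKRWFrac_of_sliceSemiMonoWeakKRWFrac'⟩

/-! ### Calibration: the `m = 1` shadow of the host-language weak KRW is again P1 -/

theorem sliceMonoHardExist_of_sliceSemiMonoWeakKRW (h0 : SliceSemiMonoWeakKRW) : SliceMonoHardExist := by
  obtain ⟨c0, hc0⟩ := h0
  refine ⟨c0, fun n hn => ?_⟩
  have hf : ∃ a b : Fin 1 → Bool,
      (fun a : Fin 1 → Bool => a 0) a ≠ (fun a : Fin 1 → Bool => a 0) b :=
    ⟨fun _ => true, fun _ => false, by simp⟩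
  obtain ⟨k, h, hs, hh⟩ := hc0 1 n hn (fun a => a 0) hf
  refine ⟨k, h, hs, fun T hT => ?_⟩
  have hP : SolvesSemiMono (onRow (0 : Fin 1) T) (fun a => a 0) h := by
    intro X Y hX hY
    simp only [blockComp, rowLabels] at hX hY
    obtain ⟨h1, h2⟩ := hT (row X 0) (row Y 0) hX hY
    left
    simp only [run_onRow, rowLabels, hX, hY]
    exact ⟨by simp, h1, h2⟩
  obtain ⟨Q, -, hQd⟩ := hh _ hP
  simp only [depth_onRow, one_mul] at hQd
  omega

/-! ### Conjecture 2 ⟹ host-language weak KRW (given P1) — directly, no orienter, no strong game -/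

theorem sliceSemiMonoWeakKRW_of_semiMonotoneKRW (hP1 : SliceMonoHardExist) (hC : SemiMonotoneKRW) :
    SliceSemiMonoWeakKRW := by
  obtain ⟨c₁, hP1⟩ := hP1
  obtain ⟨c, hC⟩ := hC
  refine ⟨c + c₁ + 1, fun m n hn f hf => ?_⟩
  obtain ⟨k₁, h, hs, hh⟩ := hP1 n hn
  have hm : 1 ≤ m := one_le_of_nonconst hf
  have hlog : Nat.log 2 n ≤ Nat.log 2 (m * n) := Nat.log_mono_right (Nat.le_mul_of_pos_left n hm)
  have hlog' : c₁ * (Nat.log 2 n + 1) ≤ c₁ * (Nat.log 2 (m * n) + 1) :=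
    Nat.mul_le_mul_left c₁ (Nat.add_le_add_right hlog 1)
  have hsplit : (c + c₁ + 1) * (Nat.log 2 (m * n) + 1) =
      c * (Nat.log 2 (m * n) + 1) + c₁ * (Nat.log 2 (m * n) + 1) + (Nat.log 2 (m * n) + 1) := by ring
  by_cases hnc : ∃ u v, h u ≠ h v
  · refine ⟨k₁, h, hs, fun P hP => ?_⟩
    obtain ⟨Q, hQ, R, hR, hd⟩ := hC m n hn f hf h hs.monotone hnc P hP
    refine ⟨Q, hQ, ?_⟩
    have hn_le : n ≤ R.depth + c₁ * (Nat.log 2 n + 1) := hh R hR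
    rw [hsplit]
    generalize c * (Nat.log 2 (m * n) + 1) = L at hd ⊢
    generalize c₁ * (Nat.log 2 (m * n) + 1) = L₁ at hlog' ⊢
    generalize c₁ * (Nat.log 2 n + 1) = L₂ at hn_le hlog'
    omega
  · push Not at hnc
    have hsmall : n ≤ c₁ * (Nat.log 2 n + 1) := by
      have h0 := hh (leaf ⟨0, hn⟩) (fun a b ha hb => absurd ((hnc a b).symm.trans ha) (by rw [hb]; decide))
      simpa using h0
    refine ⟨1, thr n 1, isSlice_thr n 1, fun P hP => ?_⟩
    obtain ⟨Q, hQ, R, -, hd⟩ :=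
      hC m n hn f hf (thr n 1) (isSlice_thr n 1).monotone (thr_one_nonconst hn) P hP
    refine ⟨Q, hQ, ?_⟩
    rw [hsplit]
    generalize c * (Nat.log 2 (m * n) + 1) = L at hd ⊢
    generalize c₁ * (Nat.log 2 (m * n) + 1) = L₁ at hlog' ⊢
    generalize c₁ * (Nat.log 2 n + 1) = L₂ at hsmall hlog'
    omega

theorem sliceSemiMonoWeakKRWFrac_of_semiMonotoneKRWFrac (hP1 : SliceMonoHardExist)
    (hC : SemiMonotoneKRWFrac) : SliceSemiMonoWeakKRWFrac := by
  obtain ⟨c₁, hP1⟩ := hP1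
  obtain ⟨c, k, hk, hC⟩ := hC
  refine ⟨c + c₁ + 1, k, hk, fun m n hn f hf => ?_⟩
  obtain ⟨k₁, h, hs, hh⟩ := hP1 n hn
  have hm : 1 ≤ m := one_le_of_nonconst hf
  have hlog : Nat.log 2 n ≤ Nat.log 2 (m * n) := Nat.log_mono_right (Nat.le_mul_of_pos_left n hm)
  have hsplit : (c + c₁ + 1) * (Nat.log 2 (m * n) + 1) =
      c * (Nat.log 2 (m * n) + 1) + c₁ * (Nat.log 2 (m * n) + 1) + (Nat.log 2 (m * n) + 1) := by ring
  by_cases hnc : ∃ u v, h u ≠ h v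
  · refine ⟨k₁, h, hs, fun P hP => ?_⟩
    obtain ⟨Q, hQ, R, hR, hd⟩ := hC m n hn f hf h hs.monotone hnc P hP
    refine ⟨Q, hQ, ?_⟩
    have hn_le : n ≤ R.depth + c₁ * (Nat.log 2 n + 1) := hh R hR
    have h1 : n / k ≤ R.depth / k + c₁ * (Nat.log 2 (m * n) + 1) := by
      calc n / k ≤ (R.depth + (c₁ * (Nat.log 2 (m * n) + 1)) * k) / k := by
            apply Nat.div_le_div_right
            calc n ≤ R.depth + c₁ * (Nat.log 2 n + 1) := hn_le
              _ ≤ R.depth + c₁ * (Nat.log 2 (m * n) + 1) := by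
                  have := Nat.mul_le_mul_left c₁ (Nat.add_le_add_right hlog 1); omega
              _ ≤ R.depth + (c₁ * (Nat.log 2 (m * n) + 1)) * k := by
                  have := Nat.le_mul_of_pos_right (c₁ * (Nat.log 2 (m * n) + 1)) hk; omega
        _ = R.depth / k + c₁ * (Nat.log 2 (m * n) + 1) := Nat.add_mul_div_right _ _ hk
    rw [hsplit]
    generalize n / k = q at h1 ⊢
    generalize R.depth / k = r at hd h1
    generalize c * (Nat.log 2 (m * n) + 1) = L at hd ⊢
    generalize c₁ * (Nat.log 2 (m * n) + 1) = L₁ at h1 ⊢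
    omega
  · push Not at hnc
    have hsmall : n ≤ c₁ * (Nat.log 2 n + 1) := by
      have h0 := hh (leaf ⟨0, hn⟩) (fun a b ha hb => absurd ((hnc a b).symm.trans ha) (by rw [hb]; decide))
      simpa using h0
    refine ⟨1, thr n 1, isSlice_thr n 1, fun P hP => ?_⟩
    obtain ⟨Q, hQ, R, -, hd⟩ :=
      hC m n hn f hf (thr n 1) (isSlice_thr n 1).monotone (thr_one_nonconst hn) P hP
    refine ⟨Q, hQ, ?_⟩
    have h1 : n / k ≤ c₁ * (Nat.log 2 (m * n) + 1) :=
      (Nat.div_le_self n k).trans (hsmall.trans (Nat.mul_le_mul_left c₁ (by omega)))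
    rw [hsplit]
    generalize n / k = q at h1 ⊢
    generalize R.depth / k = r at hd
    generalize c * (Nat.log 2 (m * n) + 1) = L at hd ⊢
    generalize c₁ * (Nat.log 2 (m * n) + 1) = L₁ at h1 ⊢
    omega

/-! ### The direct chain: Conjecture 2 ∧ P1 ⟹ weak KRW ⟹ P ⊄ NC¹ ⟹ (R) PneNP -/

/-- **HOST ⟹ WEAK KRW (additive reading), kernel-checked, no C1, no C2.** -/
theorem weakKRW_of_semiMonotoneKRW (hP1 : SliceMonoHardExist) (hC : SemiMonotoneKRW) : WeakKRW :=
  weakKRW_of_sliceSemiMonoWeakKRW' (sliceSemiMonoWeakKRW_of_semiMonotoneKRW hP1 hC)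

/-- **HOST ⟹ WEAK KRW (fraction reading).** -/
theorem weakKRWFrac_of_semiMonotoneKRWFrac (hP1 : SliceMonoHardExist) (hC : SemiMonotoneKRWFrac) :
    WeakKRWFrac :=
  weakKRWFrac_of_sliceSemiMonoWeakKRWFrac' (sliceSemiMonoWeakKRWFrac_of_semiMonotoneKRWFrac hP1 hC)

/-- The landed S3, restated over `WeakKRW` (its hypothesis verbatim). -/
theorem notNC1_of_weakKRW (hW : WeakKRW) : ∃ L ∈ Classes.P, L ∉ NC1 :=
  (Summit.PneNP.PneNP.Theorems.CompositionIteration_proof :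
    Summit.PneNP.PneNP.Theses.KrwChromaticSteering.CompositionIteration) hW

/-- **dRMNPR Conjecture 2 (additive reading) + P1 ⟹ `P ⊄ NC¹`** — kernel-checked modulo the hypothesis
`SliceMonoHardExist` (PROVED, `SliceMonoHard.sliceMonoHardExist_holds`, verbatim body). -/
theorem notNC1_of_semiMonotoneKRW (hP1 : SliceMonoHardExist) (hC : SemiMonotoneKRW) :
    ∃ L ∈ Classes.P, L ∉ NC1 :=
  notNC1_of_weakKRW (weakKRW_of_semiMonotoneKRW hP1 hC)

/-- **Conjecture 2 + P1 + the route's declared residual R ⟹ PneNP** (conditional glue; `P ≠ NP` is NOT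
proved here: `SemiMonotoneKRW` is an open conjecture and `FormulaLayerLift` the route's S-implied residual). -/
theorem pneNP_of_semiMonotoneKRW (hP1 : SliceMonoHardExist) (hC : SemiMonotoneKRW)
    (hR : Summit.PneNP.PneNP.Theses.KrwChromaticSteering.FormulaLayerLift) : PneNP := by
  refine hR fun hsub => ?_
  obtain ⟨L, hLP, hLNC⟩ := notNC1_of_semiMonotoneKRW hP1 hC
  exact hLNC (hsub hLP)

/-- Fraction reading: Conjecture 2-frac + P1 + the PROVED fractional iteration (`CompositionIterationFrac`,
hypothesis here, `compositionIterationFrac_holds` in its workfile) + R ⟹ PneNP. -/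
theorem pneNP_of_semiMonotoneKRWFrac (hP1 : SliceMonoHardExist) (hC : SemiMonotoneKRWFrac)
    (hB : CompositionIterationFrac)
    (hR : Summit.PneNP.PneNP.Theses.KrwChromaticSteering.FormulaLayerLift) : PneNP := by
  refine hR fun hsub => ?_
  obtain ⟨L, hLP, hLNC⟩ := hB (weakKRWFrac_of_semiMonotoneKRWFrac hP1 hC)
  exact hLNC (hsub hLP)

/-! ### Status (v5 summary)

additive:  `SemiMonotoneKRW ∧ P1 ⟹ SliceSemiMonoWeakKRW ⟹ WeakKRW ⟹ P ⊄ NC¹`   and   `⟹ SliceStrongComposition ⟹ C1` (v4);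
fraction:  `SemiMonotoneKRWFrac ∧ P1 ⟹ SliceSemiMonoWeakKRWFrac ⟺ WeakKRWFrac ⟹ P ⊄ NC¹`   and
           `⟹ SliceStrongCompositionFrac ⟺ StrongCompositionFrac` (v4);
route:     `C1 ∧ C2 ⟹ WeakKRW` (`Theses/KrwChromaticSteering.lean`, `weakKRW_of`).  The direct chain does not
discharge C2 — it does not pass through the strong game at all. -/

/-! ### v6 — Conjecture 2 is needed only for EASY outer functions (the chain relativised)

The KRW tower started at the dictator composes only with polynomially EASY outer functions
(`Cruxes/StrongComposition/EasyOuterIterationFrac.lean`, seat g5: `notNC1_of_easyOuterWeakKRWFrac :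
EasyOuterWeakKRWFrac → ∃ L ∈ P, L ∉ NC¹`, PROVED, sorry-free; named below as the hypothesis
`EasyOuterIterationFrac` because crux workfiles do not import one another).  The direct chain of v5 is
pointwise in the outer function `f`, so it relativises to ANY outer predicate `Φ`; at `Φ = EasyOuter`:
dRMNPR's Conjecture 2 (fraction reading) FOR EASY OUTER `f` ONLY, plus P1, gives `P ⊄ NC¹`. -/

/-- VERBATIM `EasyOuterDoor.EasyOuter` = `EasyOuterIterationFrac.EasyOuter`: `f` is polynomially easy —
some `KW_f` protocol has depth `D` with `D² ≤ 4·m·(⌊log₂ m⌋+1)²`. -/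
def EasyOuter {m : ℕ} (f : (Fin m → Bool) → Bool) : Prop :=
  ∃ Q₀ : KWTree (Fin m), Q₀.Solves f ∧ Q₀.depth * Q₀.depth ≤ 4 * m * (Nat.log 2 m + 1) ^ 2

/-- VERBATIM `EasyOuterIterationFrac.EasyOuterWeakKRWFrac`: weak KRW (fraction scale) demanded for easy
non-constant outer functions only. OPEN. -/
def EasyOuterWeakKRWFrac : Prop :=
  ∃ c k : ℕ, 0 < k ∧ ∀ m n : ℕ, 1 ≤ n → ∀ f : (Fin m → Bool) → Bool, (∃ a b, f a ≠ f b) →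
    EasyOuter f →
    ∃ g : (Fin n → Bool) → Bool, ∀ P : KWTree (Fin m × Fin n), P.Solves (blockComp f g) →
      ∃ Q : KWTree (Fin m), Q.Solves f ∧ Q.depth + n / k ≤ P.depth + c * (Nat.log 2 (m * n) + 1)

/-- The PROVED theorem `EasyOuterIterationFrac.notNC1_of_easyOuterWeakKRWFrac`, as a named hypothesis. -/
def EasyOuterIterationFrac : Prop :=
  EasyOuterWeakKRWFrac → ∃ L ∈ Classes.P, L ∉ NC1

/-- Conjecture 2 (fraction reading) demanded only for outer functions satisfying `Φ`. -/
def SemiMonotoneKRWFracFor (Φ : ∀ {m : ℕ}, ((Fin m → Bool) → Bool) → Prop) : Prop :=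
  ∃ c k : ℕ, 0 < k ∧ ∀ m n : ℕ, 1 ≤ n → ∀ f : (Fin m → Bool) → Bool, (∃ a b, f a ≠ f b) → Φ f →
    ∀ g : (Fin n → Bool) → Bool, Monotone g → (∃ u v, g u ≠ g v) →
      ∀ P : KWTree (Fin m × Fin n), SolvesSemiMono P f g →
        ∃ Q : KWTree (Fin m), Q.Solves f ∧ ∃ R : KWTree (Fin n), R.SolvesMono g ∧
          Q.depth + R.depth / k ≤ P.depth + c * (Nat.log 2 (m * n) + 1)

/-- Host-language weak KRW (fraction scale) for outer functions satisfying `Φ`. -/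
def SliceSemiMonoWeakKRWFracFor (Φ : ∀ {m : ℕ}, ((Fin m → Bool) → Bool) → Prop) : Prop :=
  ∃ c k₀ : ℕ, 0 < k₀ ∧ ∀ m n : ℕ, 1 ≤ n → ∀ f : (Fin m → Bool) → Bool, (∃ a b, f a ≠ f b) → Φ f →
    ∃ k : ℕ, ∃ h : (Fin n → Bool) → Bool, IsSlice k h ∧
      ∀ P : KWTree (Fin m × Fin n), SolvesSemiMono P f h →
        ∃ Q : KWTree (Fin m), Q.Solves f ∧ Q.depth + n / k₀ ≤ P.depth + c * (Nat.log 2 (m * n) + 1)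

/-- Weak KRW (fraction scale) for outer functions satisfying `Φ`. -/
def WeakKRWFracFor (Φ : ∀ {m : ℕ}, ((Fin m → Bool) → Bool) → Prop) : Prop :=
  ∃ c k : ℕ, 0 < k ∧ ∀ m n : ℕ, 1 ≤ n → ∀ f : (Fin m → Bool) → Bool, (∃ a b, f a ≠ f b) → Φ f →
    ∃ g : (Fin n → Bool) → Bool, ∀ P : KWTree (Fin m × Fin n), P.Solves (blockComp f g) →
      ∃ Q : KWTree (Fin m), Q.Solves f ∧ Q.depth + n / k ≤ P.depth + c * (Nat.log 2 (m * n) + 1)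

/-- The unrelativised conjecture is the case `Φ = ⊤` (and implies every relativisation). -/
theorem semiMonotoneKRWFracFor_of_semiMonotoneKRWFrac (Φ : ∀ {m : ℕ}, ((Fin m → Bool) → Bool) → Prop)
    (h : SemiMonotoneKRWFrac) : SemiMonotoneKRWFracFor Φ := by
  obtain ⟨c, k, hk, hc⟩ := h
  exact ⟨c, k, hk, fun m n hn f hf _ => hc m n hn f hf⟩

theorem weakKRWFracFor_top_iff : WeakKRWFracFor (fun _ => True) ↔ WeakKRWFrac := by
  constructor
  · rintro ⟨c, k, hk, hc⟩
    exact ⟨c, k, hk, fun m n hn f hf => hc m n hn f hf trivial⟩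
  · rintro ⟨c, k, hk, hc⟩
    exact ⟨c, k, hk, fun m n hn f hf _ => hc m n hn f hf⟩

theorem weakKRWFracFor_easy_iff : WeakKRWFracFor EasyOuter ↔ EasyOuterWeakKRWFrac := Iff.rfl

/-- Conjecture 2 for `Φ`-outer functions + P1 ⟹ host-language weak KRW for `Φ`-outer functions
(the proof of `sliceSemiMonoWeakKRWFrac_of_semiMonotoneKRWFrac`, verbatim with `Φ` threaded). -/
theorem sliceSemiMonoWeakKRWFracFor_of (Φ : ∀ {m : ℕ}, ((Fin m → Bool) → Bool) → Prop)
    (hP1 : SliceMonoHardExist) (hC : SemiMonotoneKRWFracFor Φ) : SliceSemiMonoWeakKRWFracFor Φ := by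
  obtain ⟨c₁, hP1⟩ := hP1
  obtain ⟨c, k, hk, hC⟩ := hC
  refine ⟨c + c₁ + 1, k, hk, fun m n hn f hf hΦ => ?_⟩
  obtain ⟨k₁, h, hs, hh⟩ := hP1 n hn
  have hm : 1 ≤ m := one_le_of_nonconst hf
  have hlog : Nat.log 2 n ≤ Nat.log 2 (m * n) := Nat.log_mono_right (Nat.le_mul_of_pos_left n hm)
  have hsplit : (c + c₁ + 1) * (Nat.log 2 (m * n) + 1) =
      c * (Nat.log 2 (m * n) + 1) + c₁ * (Nat.log 2 (m * n) + 1) + (Nat.log 2 (m * n) + 1) := by ring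
  by_cases hnc : ∃ u v, h u ≠ h v
  · refine ⟨k₁, h, hs, fun P hP => ?_⟩
    obtain ⟨Q, hQ, R, hR, hd⟩ := hC m n hn f hf hΦ h hs.monotone hnc P hP
    refine ⟨Q, hQ, ?_⟩
    have hn_le : n ≤ R.depth + c₁ * (Nat.log 2 n + 1) := hh R hR
    have h1 : n / k ≤ R.depth / k + c₁ * (Nat.log 2 (m * n) + 1) := by
      calc n / k ≤ (R.depth + (c₁ * (Nat.log 2 (m * n) + 1)) * k) / k := by
            apply Nat.div_le_div_right
            calc n ≤ R.depth + c₁ * (Nat.log 2 n + 1) := hn_le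
              _ ≤ R.depth + c₁ * (Nat.log 2 (m * n) + 1) := by
                  have := Nat.mul_le_mul_left c₁ (Nat.add_le_add_right hlog 1); omega
              _ ≤ R.depth + (c₁ * (Nat.log 2 (m * n) + 1)) * k := by
                  have := Nat.le_mul_of_pos_right (c₁ * (Nat.log 2 (m * n) + 1)) hk; omega
        _ = R.depth / k + c₁ * (Nat.log 2 (m * n) + 1) := Nat.add_mul_div_right _ _ hk
    rw [hsplit]
    generalize n / k = q at h1 ⊢
    generalize R.depth / k = r at hd h1
    generalize c * (Nat.log 2 (m * n) + 1) = L at hd ⊢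
    generalize c₁ * (Nat.log 2 (m * n) + 1) = L₁ at h1 ⊢
    omega
  · push Not at hnc
    have hsmall : n ≤ c₁ * (Nat.log 2 n + 1) := by
      have h0 := hh (leaf ⟨0, hn⟩) (fun a b ha hb => absurd ((hnc a b).symm.trans ha) (by rw [hb]; decide))
      simpa using h0
    refine ⟨1, thr n 1, isSlice_thr n 1, fun P hP => ?_⟩
    obtain ⟨Q, hQ, R, -, hd⟩ :=
      hC m n hn f hf hΦ (thr n 1) (isSlice_thr n 1).monotone (thr_one_nonconst hn) P hP
    refine ⟨Q, hQ, ?_⟩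
    have h1 : n / k ≤ c₁ * (Nat.log 2 (m * n) + 1) :=
      (Nat.div_le_self n k).trans (hsmall.trans (Nat.mul_le_mul_left c₁ (by omega)))
    rw [hsplit]
    generalize n / k = q at h1 ⊢
    generalize R.depth / k = r at hd
    generalize c * (Nat.log 2 (m * n) + 1) = L at hd ⊢
    generalize c₁ * (Nat.log 2 (m * n) + 1) = L₁ at h1 ⊢
    omega

/-- Host language ⟹ weak KRW, relativised (the orienter direction, verbatim with `Φ` threaded). -/
theorem weakKRWFracFor_of_slice (Φ : ∀ {m : ℕ}, ((Fin m → Bool) → Bool) → Prop)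
    (hT : ThresholdMonoLogDepth) (h0 : SliceSemiMonoWeakKRWFracFor Φ) : WeakKRWFracFor Φ := by
  obtain ⟨cT, hcT⟩ := hT
  obtain ⟨c0, k₀, hk₀, hc0⟩ := h0
  refine ⟨c0 + cT + 3, k₀, hk₀, fun m n hn f hf hΦ => ?_⟩
  obtain ⟨k, h, hs, hh⟩ := hc0 m n hn f hf hΦ
  obtain ⟨T, hTd, hTs⟩ := hcT n k hn
  refine ⟨h, fun P hP => ?_⟩
  obtain ⟨Q, hQ, hQd⟩ := hh (graft P (orientSemi h T)) (solvesSemiMono_graft_orientSemi hs hTs hP)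
  refine ⟨Q, hQ, ?_⟩
  have hdep : (graft P (orientSemi h T)).depth ≤ P.depth + (T.depth + 3) :=
    depth_graft_le _ _ (fun ij => (depth_orientSemi h T ij).le) P
  have hm : 1 ≤ m := one_le_of_nonconst hf
  have hlog : Nat.log 2 n ≤ Nat.log 2 (m * n) := Nat.log_mono_right (Nat.le_mul_of_pos_left n hm)
  have hT' : T.depth ≤ cT * (Nat.log 2 (m * n) + 1) :=
    hTd.trans (Nat.mul_le_mul_left _ (by omega))
  have hsplit : (c0 + cT + 3) * (Nat.log 2 (m * n) + 1) =
      c0 * (Nat.log 2 (m * n) + 1) + cT * (Nat.log 2 (m * n) + 1) + 3 * (Nat.log 2 (m * n) + 1) := by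
    ring
  rw [hsplit]
  generalize n / k₀ = q at hQd ⊢
  omega

/-- **Conjecture 2 for `Φ`-outer functions + P1 ⟹ weak KRW for `Φ`-outer functions** (unconditional in
the threshold protocols, § Valiant). -/
theorem weakKRWFracFor_of (Φ : ∀ {m : ℕ}, ((Fin m → Bool) → Bool) → Prop)
    (hP1 : SliceMonoHardExist) (hC : SemiMonotoneKRWFracFor Φ) : WeakKRWFracFor Φ :=
  weakKRWFracFor_of_slice Φ thresholdMonoLogDepth_holds (sliceSemiMonoWeakKRWFracFor_of Φ hP1 hC)

/-- **dRMNPR Conjecture 2 (fraction reading) FOR EASY OUTER FUNCTIONS + P1 ⟹ weak KRW for easy outer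
functions** — kernel-checked. -/
theorem easyOuterWeakKRWFrac_of_semiMonotoneKRWFracEasy (hP1 : SliceMonoHardExist)
    (hC : SemiMonotoneKRWFracFor EasyOuter) : EasyOuterWeakKRWFrac :=
  weakKRWFracFor_of EasyOuter hP1 hC

/-- … hence `P ⊄ NC¹`, given the PROVED easy-start iteration (`EasyOuterIterationFrac`, hypothesis here,
`notNC1_of_easyOuterWeakKRWFrac` in its workfile). -/
theorem notNC1_of_semiMonotoneKRWFracEasy (hP1 : SliceMonoHardExist)
    (hC : SemiMonotoneKRWFracFor EasyOuter) (hIt : EasyOuterIterationFrac) :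
    ∃ L ∈ Classes.P, L ∉ NC1 :=
  hIt (easyOuterWeakKRWFrac_of_semiMonotoneKRWFracEasy hP1 hC)

/-- … hence `PneNP` given the route's residual R (conditional glue; `P ≠ NP` is NOT proved here —
`SemiMonotoneKRWFracFor EasyOuter` is an open conjecture). -/
theorem pneNP_of_semiMonotoneKRWFracEasy (hP1 : SliceMonoHardExist)
    (hC : SemiMonotoneKRWFracFor EasyOuter) (hIt : EasyOuterIterationFrac)
    (hR : Summit.PneNP.PneNP.Theses.KrwChromaticSteering.FormulaLayerLift) : PneNP := by
  refine hR fun hsub => ?_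
  obtain ⟨L, hLP, hLNC⟩ := notNC1_of_semiMonotoneKRWFracEasy hP1 hC hIt
  exact hLNC (hsub hLP)

/-! ### The fraction chain with the LANDED iteration (hypothesis `CompositionIterationFrac` discharged) -/

/-- FILE B is landed: `Theorems/KrwChromaticSteeringCompositionIterationFrac.lean` (p615650) proves the verbatim
statement; the two `WeakKRWFrac` / `CompositionIterationFrac` constants agree by `δ`-unfolding. -/
theorem compositionIterationFrac_holds' : CompositionIterationFrac := fun h =>
  Summit.PneNP.PneNP.Theorems.KrwChromaticSteeringCompositionIterationFrac.compositionIterationFrac_holds h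

/-- **dRMNPR Conjecture 2 (fraction reading) + P1 ⟹ `P ⊄ NC¹`** — kernel-checked; the only restated
hypothesis is P1 (`SliceMonoHardExist`, PROVED in `SliceMonoHard.lean`). -/
theorem notNC1_of_semiMonotoneKRWFrac (hP1 : SliceMonoHardExist) (hC : SemiMonotoneKRWFrac) :
    ∃ L ∈ Classes.P, L ∉ NC1 :=
  compositionIterationFrac_holds' (weakKRWFrac_of_semiMonotoneKRWFrac hP1 hC)

/-- … and `PneNP` given the residual R (conditional glue: Conjecture 2-frac is OPEN; `P ≠ NP` not proved). -/
theorem pneNP_of_semiMonotoneKRWFrac' (hP1 : SliceMonoHardExist) (hC : SemiMonotoneKRWFrac)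
    (hR : Summit.PneNP.PneNP.Theses.KrwChromaticSteering.FormulaLayerLift) : PneNP :=
  pneNP_of_semiMonotoneKRWFrac hP1 hC compositionIterationFrac_holds' hR

/-- Weak KRW for easy outer functions follows from weak KRW (fraction scale), hence from Conjecture 2-frac + P1. -/
theorem easyOuterWeakKRWFrac_of_semiMonotoneKRWFrac (hP1 : SliceMonoHardExist) (hC : SemiMonotoneKRWFrac) :
    EasyOuterWeakKRWFrac :=
  easyOuterWeakKRWFrac_of_semiMonotoneKRWFracEasy hP1 (semiMonotoneKRWFracFor_of_semiMonotoneKRWFrac _ hC)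

/-! ### Status (v6/v7 summary)

fraction:              `SemiMonotoneKRWFrac ∧ P1 ⟹ WeakKRWFrac ⟹ P ⊄ NC¹` — last arrow LANDED (p615650), chain
                       unconditional in everything but Conjecture 2-frac and (restated, proved) P1;
fraction, easy outer:  `SemiMonotoneKRWFracFor EasyOuter ∧ P1 ⟹ EasyOuterWeakKRWFrac ⟹ P ⊄ NC¹`
(the last arrow = `EasyOuterIterationFrac.notNC1_of_easyOuterWeakKRWFrac`, PROVED in its crux workfile).  The open input of the
whole embed line is now: dRMNPR's Conjecture 2 in the regime { outer `f` with `D(f) ≤ 2√m·(⌊log₂ m⌋+1)`,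
inner `g` ONE slice function per arity `n` (P1's witness), semi-monotone protocols, inner term at any constant
fraction, loss `O(log mn)` }. -/

end Summit.PneNP.PneNP.Cruxes.StrongComposition.SliceSemiMonotone
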